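import Literature.MathematicalPhysics.QuantumFieldTheory.Balaban1983to89.Beta.WoodburyFibre

/-!
# Beta / WoodburyCovariant — the Woodbury certificate of `Beta/WoodburyFibre` for ANY coarse-covariant averaging with an
admissible alias weight; instance: Bałaban's BOND-block average (`μ`-component, `U = 1`), weight `w = u · v_μ`.
`A_B⁻¹ = C^⊥ + |𝕋|⁻¹(m²+a)⁻¹ − R^lat_w` EXACTLY, and `|R^lat_w| ≤ D₀ᶜL⁻²`, `|∇R| ≤ D₁ᶜL⁻³`, `|∇R∇′| ≤ D₂ᶜL⁻⁴` (`d = 4`)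
UNIFORMLY IN THE VOLUME and in `a > 0`, massless endpoint included

HONEST FRAMING (verbatim, page 1 of everything this cell writes): discharging `BetaPertH` makes Bałaban's UV
stability UNCONDITIONAL — a real constructive-QFT result; it is NOT the continuum limit and NOT the Clay problem.
ABSOLUTE RULE (verbatim): no internally-minted statement may enter as a cited fact.  Every hypothesis is either
kernel-proved in this package or a verbatim quotation of a PUBLISHED theorem with page reference; the manuscripts under
audit are NOT citable for their own disputed steps, programme-internal claims never.  THIS MODULE quotes nothing: every
statement below is a Mathlib-elementary theorem about explicit finite matrices, proved from the definitions; the two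
`[Balaban1984PropagatorsI (1.18) p.20, (1.61) p.28]` tags locate the printed DEFINITIONS that the bond instance
transcribes (context, not hypotheses); King's alias-sum technique enters only through the sibling's proved lemmas.

WHY (RULING (R10), BETA-SPEC v1.9n §7.17 (R10-1)/(R10-4)): on the primary (composed) road the window legs (W2′)₀ `hF/hG` of
`Beta.ComposedRoad.oneLoopDrift_of_composedLegInterface` are fed, for the scalar SITE-averaged model, by the kernel
certificate `Beta/WoodburyFibre` v1.1 (p181355) through `WindowInterface.windowBound_of_scaleBound`; the same ruling
assigns «bond / covariant averaging» to the an5 successors.  This file is that successor certificate.  The mechanism of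
the sibling is untouched; what changes is ONE scalar function on the fine momentum torus — the ALIAS WEIGHT.

SETTING (imported from `King1986/TorusBlockForm`, `King1986/EffectiveLaplacianSymbol`, `Beta/WoodburyFibre`; notation as
there: fine torus `Tor (fine N M)`, block side `N` = the cell's `L`, coarse torus `Tor M`, coarse momentum `q = red p`,
alias fibre `fib N M q = {pOf (m,q)}`, central alias `z q`, King's block weight `u N M p`, symbol
`σ(p) = lapSym (fine N M) c m2 p = m2 + c Σ_μ (2 − 2cos p_μ)`, off-centre alias sums `Yoff`, `Yoff2` with their VOLUME-FREE
bounds `aliasC 4 = 600`, `aliasC2 4 = 7320`).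
* §1 A real `|𝕋_coarse| × |𝕋_fine|` matrix `B` is COARSE-COVARIANT (`Covariant`) if row `b` is row `0` translated by the
  block corner `N·b`.  Its ALIAS WEIGHT is `w_B(p) = wt N M B p = Σ_x B(0,x) e^{ip·x}`; the operator treated is
  `A_B = covOp N M B a c m2 = c(−Δ₁) + m2 + a·(N^d · BᵀB)` (`gram`).  MOMENTUM KERNEL (`hat_gram`, `hat_covOp`): `N^d BᵀB`
  couples exactly the aliases of one fibre, with the rank-one kernel `|𝕋| · w_B(p) conj w_B(p″)` — for `B = Qmat` (King's
  block mean) `w_Q = u` and `A_Q = fineOp` (`wt_Qmat`, `gram_Qmat`, `covOp_Qmat`): the sibling is the `B = Q` instance.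
* §2 Sherman–Morrison on each fibre (`hat_covOp_inv`, `m2 > 0`, `a, c ≥ 0`): the fibre inverse is
  `C^w(p₀,p′) = δ/σ − κ_w(q)·(w(p₀)/σ(p₀))·(conj w(p′)/σ(p′))`, `κ_w = kapW = a/(1 + aS_w)`, `S_w = SfibW = Σ_{fib q}|w|²/σ`.
* §3 ADMISSIBILITY of a weight (`Admissible`): (W0) `w(0) = 1`; (W1) `|w(p)| ≤ |u(p)|` for all `p`; (W2)
  `|w(z_q)| ≥ (2/π)^{d+1}` at every central alias.  (`admissible_u`: King's `u` is admissible.)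

WHAT IS PROVED (every item for EVERY coarse-covariant `B` with admissible `w_B`, resp. every admissible `w`).
* §4 (P0) **EXACT DECOMPOSITION** (`covOp_inv_decomposition`; any `d`, any periods, `a ≥ 0`, `m2 > 0`, `N ≥ 1`, King
  scaling `c = N²`):  `A_B⁻¹(x,x′) = GfreePerp (x′ − x) + |𝕋|⁻¹(m2 + a)⁻¹ − R^⊥_w(x,x′)`,
  `R^⊥_w = RperpW = |𝕋|⁻¹ Σ_{q ≠ 0} κ_w(q) A^w_q(x) conj A^w_q(x′)`, `A^w_q(x) = fampW = Σ_{fib q} e^{−ip·x} w(p)/σ(p)` — the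
  SAME mean-zero free Green function `GfreePerp` as in the site model; the zero fibre contributes exactly the zero mode
  because (W0)+(W1) force `w = u = δ_{m,0}` on it (`Admissible.offCentre_zero`, `fampW_zero`, `SfibW_zero`).
* §5 (B0) **FLAT BOUND**, `d = 4`, equal periods `M = cM M₀`: `‖R^⊥_w(x,x′)‖ ≤ woodburyDc m2 / N⁴` for ALL `x, x′`, all
  `a > 0`, `m2 ≥ 0`, `N, M₀ ≥ 1` (`norm_RperpW_le`), `woodburyDc m2 = 5/2 + 2·600²·(π²/4)⁵·(4π² + m2)` — free of `N`, `M₀`,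
  `a`, `B`.  ENGINE (§3, any `d`): per fibre `q ≠ 0`, `|A^w_q| ≤ |w(z_q)|/σ₀ + Yoff(q)` by (W1) (`norm_fampW_le`),
  `κ_w ≤ σ₀/|w(z_q)|²` by (W2) (`kapW_le`), hence `‖κ_w A^w conj A^w‖ ≤ 2/σ₀ + 2·aliasC²·(π²/4)^{d+1}(dπ²+m2)`
  (`fibre_termW_le`) — the sibling's per-fibre bound with ONE more factor `π²/4` (the exponent `d+1` of (W2)); the
  `d = 4` shell sums `Σ_{q≠0} 1/σ₀ ≤ (5/4)M₀⁴`, `Σ 1/√σ₀ ≤ (5/2)M₀⁴` and `|𝕋| = N⁴M₀⁴` are the sibling's, by name.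
* §6 (B1)/(B2) **DIFFERENCES**: `‖∇_μ^x R^⊥_w‖ ≤ woodburyD1c m2 / N⁵` (`norm_dRperpW_le`), `‖∇_μ^x∇_ν^{x′} R^⊥_w‖ ≤
  woodburyD2c m2 / N⁶` (`norm_ddRperpW_le`), constants `mixedEc`, `doubleEc` (the sibling's with `(π/2)^{d+1}`).
* §7 (P0₀) **MASSLESS ENDPOINT** (`covOp_inv_zero_decomposition`, `isUnit_covOp_zero`; `a > 0`): the decomposition AT
  `m2 = 0` and the invertibility of `N²(−Δ₁) + aN^dBᵀB`, from `Gdec_w(m2)·A_B(m2) = 1` by entrywise continuity and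
  uniqueness of limits along `m2 → 0⁺` (`GdecW_mul_covOp_zero`).
* §8 (P0_lat) **LATTICE UNITS** (`latticeCovInv_decomposition`; `a > 0`, `m2 ≥ 0` INCLUDING `0`): with `covOp_scale`
  (`A_B(N²a; N²; N²m2) = N² • A_B(a; 1; m2)`),
    `Γ_B(x,x′) := (−Δ₁ + m² + aN^dBᵀB)⁻¹(x,x′) = GfreeLat m² (x′ − x) + |𝕋|⁻¹(m² + a)⁻¹ − R^lat_w(x,x′)`,
  `R^lat_w = RlatW = N²·R^⊥_w(N²a, N²m²)`; in `d = 4`: `‖R^lat_w‖ ≤ woodburyDc(N²m²)/L²`, `‖∇_μR^lat_w‖ ≤ woodburyD1c(N²m²)/L³`,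
  `‖∇_μ∇′_νR^lat_w‖ ≤ woodburyD2c(N²m²)/L⁴` (`norm_RlatW_le`, `norm_dRlatW_le`, `norm_ddRlatW_le`), massless list
  `norm_RlatW_zero_le` with ABSOLUTE constants.
* §9 HERMITIAN SYMMETRY `R^⊥_w(x′,x) = conj R^⊥_w(x,x′)` (`κ_w`, `|𝕋|` real; `RperpW_swap`), second-leg differences
  `dRperpW'`, `dRlatW'` and `norm_RlatW_zero_le'` (one difference on EITHER leg).
* §10 **THE BOND INSTANCE.**  `bondAvg N M μ` = the real matrix whose row `y` puts weight `N^{-(d+1)}` on the fine sites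
  `N·y + j + t e_μ` (`j ∈ {0..N−1}^d`, `t < N`): the scalar, one-component, `U = 1` transcription of Bałaban's
  «(Q_kA)_b = Σ_{x∈B^k(b₋)} η^{d+1} A([x, x(b)])», `b = ⟨y, y+e_μ⟩` [Balaban1984PropagatorsI, (1.18) p.20 — DEFINITION,
  context]; `bondAvg_eq_QvOp`: it IS the `(μ,μ)` block of the lineage's typed `B5Block118.QvOp`.  PROVED: `covariant_bondAvg`;
  **`wt_bondAvg_pOf`: `w_{bondAvg μ}(p′+l) = u(p′+l) · v_μ(p′+l)`** with `v_μ = ∂¹_μ(p′)/∂_μ(p)` = `B5Prop11Fiber.vSym`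
  [Balaban1984PropagatorsI, (1.61) p.28 — DEFINITION, context] (the extra factor is the geometric mean `(1/N)Σ_{t<N}e^{iηp_μt}`
  over the `N` fine bonds of a coarse bond, `B5Block118.avg_om`; `u = Π_ν v_ν`, `u_pOf_eq_uSym`); **`admissible_bondAvg`**:
  (W0) from `u(0) = v_μ(0) = 1`, (W1) from `|v_μ| ≤ 1` (`B5Prop11Fiber.norm_vSym_le_one`), (W2) from `|u(z_q)| ≥ (2/π)^d`
  (sibling, King (4.37)) and `|v_μ(p′)| ≥ 2/π` at the central alias (`norm_vSym_central_ge`: Jordan, `B4Strip.uFactorr_zero_ge`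
  through `B5Prop11Fiber.norm_vSym_sq`).  HENCE (`bondInv_decomposition`, every `μ`, `a > 0`, `m2 ≥ 0`, `N ≥ 1`, any `d`, any
  periods):  `(−Δ₁ + m² + aN^d(bondAvg μ)ᵀ(bondAvg μ))⁻¹(x,x′) = GfreeLat m² (x′−x) + |𝕋|⁻¹(m²+a)⁻¹ − R^lat_{u·v_μ}(x,x′)`, and in
  `d = 4` (equal periods, every volume, every `a > 0`, MASSLESS) the four bounds `|R| ≤ woodburyDc 0/L²`,
  `|∇_μR| ≤ woodburyD1c 0/L³`, `|∇′_νR| ≤ woodburyD1c 0/L³`, `|∇_μ∇′_νR| ≤ woodburyD2c 0/L⁴` (`norm_Rbond_zero_le`; massive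
  `norm_Rbond_le`; real parts in the exact `R/L^a` shape of `windowBound_of_scaleBound`: `abs_re_Rbond_zero_le`).
  NORMALISATION: the coefficient of `Σ_b|(Q_kA)_b|²` in the printed action (which power of `η` accompanies it) only
  rescales `a`; every bound here is uniform in `a > 0`, so no convention is load-bearing.

WHAT IT DOES NOT GIVE (located, not claimed).  (i) Only `U = 1` (trivial background): Bałaban's covariant averages
`Q_k(U)` for `U ≠ 1` are not coarse-covariant in the sense of §1 and are untouched.  (ii) Only the SCALAR one-component
operator `−Δ₁ + m² + aN^d(bondAvg μ)ᵀ(bondAvg μ)` acting on `A_μ` alone: its identification with (a block of) the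
vector-field propagator `G_k(U = 1)` of [Balaban1984PropagatorsI] — which also carries the gauge-fixing term and couples
components — is NOT asserted here; that dictionary (if wanted) is the assembly owner's (`ComposedRoad`, GAPS), exactly as
for the site model.  (iii) `d = 4` with EQUAL periods for the quantitative bounds (the exact identities §4/§7/§8 are for any
`d`, any periods); constants not optimised ((W2) could use `(2/π)^d·(2/π)` only in the one direction `μ`; we take the crude
uniform exponent `d+1`).  (iv) For `m2 > 0` the lattice constants are evaluated at the King mass `N²m²` (uniform in `L` only
for `m² ≲ L⁻²`); the cell's use is `m2 = 0`.  (v) Nothing about `C_k`, the far region, table identification, `β`, `κ_Bal`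
or its sign; no continuum statement of any kind.
Cell records: RULING (R10) (BETA-SPEC v1.9n §7.17), AN5.md §10.  Unit `b2b-balaban-beta-an5-g6` (DEDICATED β sub-cell row
BETA-an5, gen 6; journal node BETA-an5-g6-WOODBURY-COVARIANT); staged byte-identically under `HOME/lean/BalabanYm4/`.
Value = kernel certificate of a located estimate for a toy operator, NOT summit progress.
-/

noncomputable section

open Finset Real Matrix
open scoped BigOperators ComplexConjugate

namespace Literature.MathematicalPhysics.QuantumFieldTheory.Balaban1983to89.Beta.WoodburyCovariant

open Literature.MathematicalPhysics.QuantumFieldTheory.King1986.Torus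
open Literature.MathematicalPhysics.QuantumFieldTheory.Balaban1983to89.B5Prop11Plancherel (Tor fine chi sOf
  abs_sOf_le conj_chi chi_zero_left chi_add_left chi_add_right sum_chi unitVec)
open Literature.MathematicalPhysics.QuantumFieldTheory.Balaban1983to89.B4Strip (uFactorr uFactorr_nonneg
  uFactorr_zero_ge)
open Literature.MathematicalPhysics.QuantumFieldTheory.Balaban1983to89.B5Block118 (pOf pOf_injective)
open Literature.MathematicalPhysics.QuantumFieldTheory.Balaban1983to89.Beta.WoodburyFibre

variable {d : ℕ}

/-! ## §1 Coarse-covariant averaging operators `B : ℓ²(𝕋_fine) → ℓ²(𝕋_coarse)`, their alias weight `w_B`, and the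
operator `c(−Δ) + m² + a·N^d BᵀB` with its momentum kernel on the alias fibres -/

section Operator

variable (N : ℕ) [NeZero N] (M : Fin d → ℕ) [hM : ∀ μ, NeZero (M μ)]

/-- COARSE COVARIANCE of an averaging matrix `B : (coarse sites) × (fine sites) → ℝ`: `B(b, x) = B(0, x − N·b)` — the
row of block `b` is the row of block `0` translated by the block corner `N·b`. [folklore] -/
def Covariant (B : Matrix (Tor M) (Tor (fine N M)) ℝ) : Prop :=
  ∀ b x, B b x = B 0 (x - corner N M b)

/-- THE ALIAS WEIGHT of `B`: `w_B(p) = Σ_x B(0,x) e^{ip·x}` (for King's block mean `Q` this is `u(p)`, `wt_Qmat`; for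
Bałaban's block-and-contour average of the `μ`-component it is `u(p)·v_μ(p)`, `wt_bondAvg_pOf`). [folklore] -/
def wt (B : Matrix (Tor M) (Tor (fine N M)) ℝ) (p : Tor (fine N M)) : ℂ :=
  ∑ x, (B 0 x : ℂ) * chi (fine N M) p x

/-- THE GRAM PROJECTOR-LIKE MATRIX `N^d · BᵀB` (for `B = Q` this is King's block-mean projector `Q*Q = blockProj`,
`gram_Qmat`). [folklore] -/
def gram (B : Matrix (Tor M) (Tor (fine N M)) ℝ) : Matrix (Tor (fine N M)) (Tor (fine N M)) ℝ :=
  ((N : ℝ) ^ d) • (Bᵀ * B)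

/-- THE OPERATOR `A_B = c·(−Δ) + m² + a·N^d BᵀB` on the fine torus (`c = N²` = King's scaling, `c = 1` = lattice
units). [folklore] -/
def covOp (B : Matrix (Tor M) (Tor (fine N M)) ℝ) (a c m2 : ℝ) : Matrix (Tor (fine N M)) (Tor (fine N M)) ℝ :=
  lapF (fine N M) c m2 + a • gram N M B

/-- `⟨x, N^d BᵀB x⟩ = N^d ‖Bx‖² ≥ 0`. [folklore] -/
theorem gram_form_nonneg (B : Matrix (Tor M) (Tor (fine N M)) ℝ) (x : Tor (fine N M) → ℝ) :
    0 ≤ x ⬝ᵥ (gram N M B *ᵥ x) := by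
  rw [gram, Matrix.smul_mulVec, dotProduct_smul, smul_eq_mul, ← Matrix.mulVec_mulVec,
    Matrix.dotProduct_mulVec, Matrix.vecMul_transpose]
  exact mul_nonneg (by positivity) (Finset.sum_nonneg fun i _ => mul_self_nonneg _)

/-- `A_B ≥ m²` (for `a, c ≥ 0`). [folklore] -/
theorem covOp_coercive (B : Matrix (Tor M) (Tor (fine N M)) ℝ) {a c : ℝ} (m2 : ℝ) (ha : 0 ≤ a) (hc : 0 ≤ c) :
    QGQInverse.Coercive (covOp N M B a c m2) m2 := by
  intro x
  rw [covOp, Matrix.add_mulVec, dotProduct_add, Matrix.smul_mulVec, dotProduct_smul, smul_eq_mul]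
  have h1 := lapF_coercive (fine N M) c m2 hc x
  have h2 := gram_form_nonneg N M B x
  nlinarith [mul_nonneg ha h2]

/-- `A_B` is invertible when `m² > 0`. [folklore] -/
theorem covOp_isUnit (B : Matrix (Tor M) (Tor (fine N M)) ℝ) {a c m2 : ℝ} (ha : 0 ≤ a) (hc : 0 ≤ c) (hm : 0 < m2) :
    IsUnit (covOp N M B a c m2) :=
  QGQInverse.isUnit_of_coercive hm (covOp_coercive N M B m2 ha hc)

omit [NeZero N] in
/-- `A_B` is symmetric. [folklore] -/
theorem covOp_transpose (B : Matrix (Tor M) (Tor (fine N M)) ℝ) (a c m2 : ℝ) :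
    (covOp N M B a c m2)ᵀ = covOp N M B a c m2 := by
  rw [covOp, gram, Matrix.transpose_add, Matrix.transpose_smul, Matrix.transpose_smul, Matrix.transpose_mul,
    Matrix.transpose_transpose]
  congr 1
  ext z z'
  rw [Matrix.transpose_apply, lapF_comm]

omit [NeZero N] in
/-- Scaling: `A_B(c·a, c, c·m²) = c · A_B(a, 1, m²)`. [folklore] -/
theorem covOp_scale (B : Matrix (Tor M) (Tor (fine N M)) ℝ) (a c m2 : ℝ) :
    covOp N M B (c * a) c (c * m2) = c • covOp N M B a 1 m2 := by
  ext z z'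
  simp only [covOp, lapF, Matrix.add_apply, Matrix.smul_apply, smul_eq_mul]
  ring

/-- For King's block mean `Q`: `N^d QᵀQ = Q*Q` (`blockProj`). [folklore] -/
theorem gram_Qmat : gram N M (Qmat N M) = blockProj N M := by
  have hNd : ((N : ℝ) ^ d) ≠ 0 := pow_ne_zero _ (by exact_mod_cast NeZero.ne N)
  rw [gram, transpose_Qmat_mul_Qmat, smul_smul, mul_inv_cancel₀ hNd, one_smul]

/-- For King's block mean: `A_Q = King's A₀` (`fineOp`). [folklore] -/
theorem covOp_Qmat (a c m2 : ℝ) : covOp N M (Qmat N M) a c m2 = fineOp N M a c m2 := by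
  rw [covOp, gram_Qmat, fineOp]

omit [NeZero N] in
/-- `N·(b − b′) = N·b − N·b′` on the fine torus. [folklore] -/
theorem corner_sub (b b' : Tor M) : corner N M (b - b') = corner N M b - corner N M b' := by
  rw [corner_eq_up, corner_eq_up, corner_eq_up]
  funext ν
  simp only [B5Block118.up, Pi.sub_apply, map_sub]

omit [NeZero N] in
/-- `N·(b + b′) = N·b + N·b′` on the fine torus. [folklore] -/
theorem corner_add (b b' : Tor M) : corner N M (b + b') = corner N M b + corner N M b' := by
  rw [corner_eq_up, corner_eq_up, corner_eq_up, B5Block118.up_add]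

/-- `Q` is coarse-covariant. [folklore] -/
theorem covariant_Qmat : Covariant N M (Qmat N M) := by
  intro b x
  obtain ⟨⟨b', j⟩, rfl⟩ := (blockEquiv N M).surjective x
  have hx : blockEquiv N M (b', j) - corner N M b = site N M (b' - b) j := by
    rw [blockEquiv_apply, site_eq, site_eq, corner_sub]
    abel
  rw [hx, blockEquiv_apply]
  simp only [Qmat, blockOf_site]
  exact if_congr sub_eq_zero.symm rfl rfl

/-- The alias weight of `Q` is King's `u`. [folklore] -/
theorem wt_Qmat (p : Tor (fine N M)) : wt N M (Qmat N M) p = u N M p := by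
  unfold wt u
  have h : ∑ x, ((Qmat N M 0 x : ℝ) : ℂ) * chi (fine N M) p x
      = ∑ bj : Tor M × (Fin d → Fin N), ((Qmat N M 0 (site N M bj.1 bj.2) : ℝ) : ℂ) * chi (fine N M) p (site N M bj.1 bj.2) := by
    symm
    exact Fintype.sum_equiv (blockEquiv N M) _ _ fun bj => rfl
  rw [h, Fintype.sum_prod_type, Finset.sum_eq_single (0 : Tor M)]
  · rw [Finset.mul_sum]
    refine Finset.sum_congr rfl fun j _ => ?_
    rw [show Qmat N M 0 (site N M 0 j) = ((N : ℝ) ^ d)⁻¹ by simp [Qmat, blockOf_site], site_eq, corner_zero,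
      zero_add]
    push_cast
    ring
  · intro b _ hb
    refine Finset.sum_eq_zero fun j _ => ?_
    simp only [Qmat, blockOf_site, if_neg hb]
    push_cast
    ring
  · intro h; exact absurd (Finset.mem_univ _) h

/-- `conj w_B(p) = Σ_x B(0,x) conj e^{ip·x}` (`B` is real). [folklore] -/
theorem conj_wt (B : Matrix (Tor M) (Tor (fine N M)) ℝ) (p : Tor (fine N M)) :
    conj (wt N M B p) = ∑ x, (B 0 x : ℂ) * conj (chi (fine N M) p x) := by
  unfold wt
  rw [map_sum]
  refine Finset.sum_congr rfl fun x _ => ?_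
  rw [map_mul, Complex.conj_ofReal]

/-- `|w_B(p)|` is even: `‖w_B(−p)‖ = ‖w_B(p)‖`. [folklore] -/
theorem norm_wt_neg (B : Matrix (Tor M) (Tor (fine N M)) ℝ) (p : Tor (fine N M)) :
    ‖wt N M B (-p)‖ = ‖wt N M B p‖ := by
  rw [← Complex.norm_conj (wt N M B p), conj_wt]
  unfold wt
  simp_rw [conj_chi]

/-- A covariant row: `Σ_y B(b,y) e^{ip·y} = e^{ip·Nb} w_B(p)`. [folklore] -/
theorem sum_row_chi {B : Matrix (Tor M) (Tor (fine N M)) ℝ} (hB : Covariant N M B) (b : Tor M) (p : Tor (fine N M)) :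
    ∑ y, (B b y : ℂ) * chi (fine N M) p y = chi (fine N M) p (corner N M b) * wt N M B p := by
  unfold wt
  rw [Finset.mul_sum]
  symm
  refine Fintype.sum_equiv (Equiv.addRight (corner N M b)) _ _ fun x => ?_
  simp only [Equiv.coe_addRight, hB b (x + corner N M b), add_sub_cancel_right, chi_add_right]
  ring

/-- A covariant row against conjugate waves: `Σ_y B(b,y) conj e^{ip·y} = conj e^{ip·Nb} conj w_B(p)`. [folklore] -/
theorem sum_row_conj_chi {B : Matrix (Tor M) (Tor (fine N M)) ℝ} (hB : Covariant N M B) (b : Tor M)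
    (p : Tor (fine N M)) :
    ∑ y, (B b y : ℂ) * conj (chi (fine N M) p y) = conj (chi (fine N M) p (corner N M b)) * conj (wt N M B p) := by
  rw [conj_wt, Finset.mul_sum]
  symm
  refine Fintype.sum_equiv (Equiv.addRight (corner N M b)) _ _ fun x => ?_
  simp only [Equiv.coe_addRight, hB b (x + corner N M b), add_sub_cancel_right, chi_add_right, map_mul]
  ring

/-- **THE MOMENTUM KERNEL OF `N^d BᵀB`**: `(N^d BᵀB)^(p,p″) = |𝕋|·[red p = red p″]·w_B(p) conj w_B(p″)` — rank one on each
alias fibre, exactly as King's `Q*Q` (`hat_blockProj_eq`) with `u` replaced by `w_B`. [folklore] -/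
theorem hat_gram {B : Matrix (Tor M) (Tor (fine N M)) ℝ} (hB : Covariant N M B) (p p'' : Tor (fine N M)) :
    hat (fine N M) (gram N M B) p p''
      = (if red N M p = red N M p'' then (Fintype.card (Tor (fine N M)) : ℂ) else 0) * (wt N M B p * conj (wt N M B p'')) := by
  rw [gram, hat_smul]
  have hT : ∀ y y', (((Bᵀ * B) y y' : ℝ) : ℂ) = ∑ b, (B b y : ℂ) * (B b y' : ℂ) := by
    intro y y'
    simp only [Matrix.mul_apply, Matrix.transpose_apply, Complex.ofReal_sum, Complex.ofReal_mul]
  have h1 : hat (fine N M) (Bᵀ * B) p p''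
      = ∑ b, (∑ y, (B b y : ℂ) * chi (fine N M) p y) * (∑ y', (B b y' : ℂ) * conj (chi (fine N M) p'' y')) := by
    unfold hat
    calc ∑ y, ∑ y', chi (fine N M) p y * (((Bᵀ * B) y y' : ℝ) : ℂ) * conj (chi (fine N M) p'' y')
        = ∑ y, ∑ y', ∑ b, chi (fine N M) p y * ((B b y : ℂ) * (B b y' : ℂ)) * conj (chi (fine N M) p'' y') := by
          refine Finset.sum_congr rfl fun y _ => Finset.sum_congr rfl fun y' _ => ?_
          rw [hT, Finset.mul_sum, Finset.sum_mul]
      _ = ∑ y, ∑ b, ∑ y', chi (fine N M) p y * ((B b y : ℂ) * (B b y' : ℂ)) * conj (chi (fine N M) p'' y') :=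
          Finset.sum_congr rfl fun y _ => Finset.sum_comm
      _ = ∑ b, ∑ y, ∑ y', chi (fine N M) p y * ((B b y : ℂ) * (B b y' : ℂ)) * conj (chi (fine N M) p'' y') :=
          Finset.sum_comm
      _ = _ := by
          refine Finset.sum_congr rfl fun b _ => ?_
          rw [Finset.sum_mul_sum]
          refine Finset.sum_congr rfl fun y _ => Finset.sum_congr rfl fun y' _ => ?_
          ring
  rw [h1]
  simp_rw [sum_row_chi N M hB, sum_row_conj_chi N M hB]
  have h2 : ∀ b : Tor M, chi (fine N M) p (corner N M b) * wt N M B p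
        * (conj (chi (fine N M) p'' (corner N M b)) * conj (wt N M B p''))
      = wt N M B p * conj (wt N M B p'') * (chi (fine N M) p (corner N M b) * conj (chi (fine N M) p'' (corner N M b))) :=
    fun b => by ring
  simp_rw [h2]
  rw [← Finset.mul_sum, sum_chi_corner, card_fine N M]
  split_ifs <;> push_cast <;> ring

/-- THE FIBRE BLOCKS of `Â_B = |𝕋|·B_w`: `B_w(p,p″) = σ(p)δ_{pp″} + a·[red p = red p″]·w(p) conj w(p″)`. [folklore] -/
def BfibW (W : Tor (fine N M) → ℂ) (a c m2 : ℝ) (p p'' : Tor (fine N M)) : ℂ :=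
  (if p = p'' then (lapSym (fine N M) c m2 p : ℂ) else 0)
    + (if red N M p = red N M p'' then (a : ℂ) * (W p * conj (W p'')) else 0)

/-- `Â_B(p,p″) = |𝕋|·B_{w_B}(p,p″)`. [folklore] -/
theorem hat_covOp {B : Matrix (Tor M) (Tor (fine N M)) ℝ} (hB : Covariant N M B) (a c m2 : ℝ) (p p'' : Tor (fine N M)) :
    hat (fine N M) (covOp N M B a c m2) p p''
      = (Fintype.card (Tor (fine N M)) : ℂ) * BfibW N M (wt N M B) a c m2 p p'' := by
  rw [covOp, hat_add, hat_smul, hat_lapF, hat_gram N M hB]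
  unfold BfibW
  simp only [sub_eq_zero]
  split_ifs <;> ring

end Operator

/-! ## §2 The fibre inverse for a general alias weight `w` (Sherman–Morrison) and the momentum kernel of `A_B⁻¹`
(King §5 = tree `EffectiveLaplacianSymbol` §5 with `u → w`, verbatim otherwise) -/

section Fibre

variable (N : ℕ) [NeZero N] (M : Fin d → ℕ) [hM : ∀ μ, NeZero (M μ)]

/-- `S_w(q) = Σ_{p ∈ fib q} |w(p)|²/σ(p)`. [folklore] -/
def SfibW (W : Tor (fine N M) → ℂ) (c m2 : ℝ) (q : Tor M) : ℝ :=
  ∑ p ∈ fib N M q, ‖W p‖ ^ 2 / lapSym (fine N M) c m2 p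

/-- `κ_w(q) = a/(1 + aS_w(q))`. [folklore] -/
def kapW (W : Tor (fine N M) → ℂ) (a c m2 : ℝ) (q : Tor M) : ℝ := a / (1 + a * SfibW N M W c m2 q)

/-- `C_q(p₀,p′) = δ_{p₀p′}/σ(p′) − κ_w(q)·(w(p₀)/σ(p₀))·(conj w(p′)/σ(p′))`. [folklore] -/
def CfibW (W : Tor (fine N M) → ℂ) (a c m2 : ℝ) (q : Tor M) (p₀ p' : Tor (fine N M)) : ℂ :=
  (if p₀ = p' then ((lapSym (fine N M) c m2 p' : ℂ))⁻¹ else 0)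
    - (kapW N M W a c m2 q : ℂ) * (W p₀ / (lapSym (fine N M) c m2 p₀ : ℂ))
        * (conj (W p') / (lapSym (fine N M) c m2 p' : ℂ))

/-- `S_w(q) ≥ 0` (`c ≥ 0`, `m² ≥ 0`). [folklore] -/
theorem SfibW_nonneg (W : Tor (fine N M) → ℂ) {c m2 : ℝ} (hc : 0 ≤ c) (hm : 0 ≤ m2) (q : Tor M) :
    0 ≤ SfibW N M W c m2 q :=
  Finset.sum_nonneg fun p _ => div_nonneg (sq_nonneg _) (lapSym_nonneg _ hc hm p)

/-- `S_w(q)` as a complex sum `Σ conj w · w / σ`. [folklore] -/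
theorem SfibW_cast (W : Tor (fine N M) → ℂ) {c m2 : ℝ} (q : Tor M) :
    (SfibW N M W c m2 q : ℂ) = ∑ p ∈ fib N M q, conj (W p) * W p / (lapSym (fine N M) c m2 p : ℂ) := by
  unfold SfibW
  push_cast
  refine Finset.sum_congr rfl fun p _ => ?_
  rw [Complex.conj_mul']

/-- `κ_w ≥ 0` (`a, c, m² ≥ 0`). [folklore] -/
theorem kapW_nonneg (W : Tor (fine N M) → ℂ) {a c m2 : ℝ} (ha : 0 ≤ a) (hc : 0 ≤ c) (hm : 0 ≤ m2) (q : Tor M) :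
    0 ≤ kapW N M W a c m2 q := by
  have := SfibW_nonneg N M W hc hm q
  unfold kapW
  positivity

/-- `κ_w(1 + aS_w) = a`. [folklore] -/
theorem kapW_mul (W : Tor (fine N M) → ℂ) {a c m2 : ℝ} (ha : 0 ≤ a) (hc : 0 ≤ c) (hm : 0 ≤ m2) (q : Tor M) :
    kapW N M W a c m2 q * (1 + a * SfibW N M W c m2 q) = a := by
  have hS := SfibW_nonneg N M W hc hm q
  unfold kapW
  field_simp

/-- `1 − κ_wS_w = 1/(1 + aS_w)`. [folklore] -/
theorem one_sub_kapW_mul (W : Tor (fine N M) → ℂ) {a c m2 : ℝ} (ha : 0 ≤ a) (hc : 0 ≤ c) (hm : 0 ≤ m2) (q : Tor M) :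
    1 - kapW N M W a c m2 q * SfibW N M W c m2 q = (1 + a * SfibW N M W c m2 q)⁻¹ := by
  have hS := SfibW_nonneg N M W hc hm q
  have hpos : (0 : ℝ) < 1 + a * SfibW N M W c m2 q := by positivity
  unfold kapW
  field_simp
  ring

/-- Column identity: `Σ_{p ∈ fib q} C_q(p₀,p) w(p) = (w(p₀)/σ(p₀))·(1 − κ_wS_w)` for `p₀ ∈ fib q`. [folklore] -/
theorem sum_CfibW_mul_W (W : Tor (fine N M) → ℂ) {a c m2 : ℝ} (q : Tor M) {p₀ : Tor (fine N M)}
    (hp₀ : p₀ ∈ fib N M q) :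
    ∑ p ∈ fib N M q, CfibW N M W a c m2 q p₀ p * W p
      = (W p₀ / (lapSym (fine N M) c m2 p₀ : ℂ))
        * (1 - (kapW N M W a c m2 q : ℂ) * (SfibW N M W c m2 q : ℂ)) := by
  unfold CfibW
  simp_rw [sub_mul, Finset.sum_sub_distrib, ite_mul, zero_mul]
  rw [Finset.sum_ite_eq, if_pos hp₀, SfibW_cast, Finset.mul_sum]
  have : ∀ p ∈ fib N M q, (kapW N M W a c m2 q : ℂ) * (W p₀ / (lapSym (fine N M) c m2 p₀ : ℂ))
      * (conj (W p) / (lapSym (fine N M) c m2 p : ℂ)) * W p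
      = W p₀ / (lapSym (fine N M) c m2 p₀ : ℂ)
        * ((kapW N M W a c m2 q : ℂ) * (conj (W p) * W p / (lapSym (fine N M) c m2 p : ℂ))) := by
    intro p _; ring
  rw [Finset.sum_congr rfl this, ← Finset.mul_sum]
  ring

/-- Row identity: `Σ_{p′ ∈ fib q} w(p′) C_q(p,p′) = (w(p)/σ(p))·(1 − κ_wS_w)` for `p ∈ fib q`. [folklore] -/
theorem sum_W_mul_CfibW (W : Tor (fine N M) → ℂ) {a c m2 : ℝ} (q : Tor M) {p : Tor (fine N M)}
    (hp : p ∈ fib N M q) :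
    ∑ p' ∈ fib N M q, W p' * CfibW N M W a c m2 q p p'
      = (W p / (lapSym (fine N M) c m2 p : ℂ))
        * (1 - (kapW N M W a c m2 q : ℂ) * (SfibW N M W c m2 q : ℂ)) := by
  unfold CfibW
  simp_rw [mul_sub, Finset.sum_sub_distrib, mul_ite, mul_zero]
  have h1 : ∑ p' ∈ fib N M q, (if p = p' then W p' * ((lapSym (fine N M) c m2 p' : ℂ))⁻¹ else 0)
      = W p / (lapSym (fine N M) c m2 p : ℂ) := by
    rw [Finset.sum_ite_eq, if_pos hp, div_eq_mul_inv]
  rw [h1, SfibW_cast, Finset.mul_sum]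
  have : ∀ p' ∈ fib N M q, W p' * ((kapW N M W a c m2 q : ℂ) * (W p / (lapSym (fine N M) c m2 p : ℂ))
      * (conj (W p') / (lapSym (fine N M) c m2 p' : ℂ)))
      = W p / (lapSym (fine N M) c m2 p : ℂ)
        * ((kapW N M W a c m2 q : ℂ) * (conj (W p') * W p' / (lapSym (fine N M) c m2 p' : ℂ))) := by
    intro p' _; ring
  rw [Finset.sum_congr rfl this, ← Finset.mul_sum]
  ring

/-- **`C_q` is a left inverse of the fibre block**: for `p₀ ∈ fib q` and every `p″`,
`Σ_{p ∈ fib q} C_q(p₀,p) B_w(p,p″) = δ_{p₀p″}` (`m² > 0`). [folklore] -/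
theorem sum_CfibW_mul_BfibW (W : Tor (fine N M) → ℂ) {a c m2 : ℝ} (ha : 0 ≤ a) (hc : 0 ≤ c) (hm : 0 < m2)
    (q : Tor M) {p₀ : Tor (fine N M)} (hp₀ : p₀ ∈ fib N M q) (p'' : Tor (fine N M)) :
    ∑ p ∈ fib N M q, CfibW N M W a c m2 q p₀ p * BfibW N M W a c m2 p p''
      = if p₀ = p'' then 1 else 0 := by
  have hq : red N M p₀ = q := (Finset.mem_filter.mp hp₀).2
  have hσ : ∀ p : Tor (fine N M), (lapSym (fine N M) c m2 p : ℂ) ≠ 0 := fun p => by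
    exact_mod_cast (lt_of_lt_of_le hm (lapSym_ge (fine N M) c m2 hc p)).ne'
  have hB : ∀ p ∈ fib N M q, BfibW N M W a c m2 p p''
      = (if p = p'' then (lapSym (fine N M) c m2 p'' : ℂ) else 0)
        + (if q = red N M p'' then (a : ℂ) * conj (W p'') else 0) * W p := by
    intro p hp
    have hpq : red N M p = q := (Finset.mem_filter.mp hp).2
    unfold BfibW
    rw [hpq]
    congr 1
    · split_ifs with h
      · rw [h]
      · rfl
    · split_ifs <;> ring
  rw [Finset.sum_congr rfl fun p hp => by rw [hB p hp, mul_add]]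
  rw [Finset.sum_add_distrib]
  have h1 : ∑ p ∈ fib N M q, CfibW N M W a c m2 q p₀ p * (if p = p'' then (lapSym (fine N M) c m2 p'' : ℂ) else 0)
      = if p'' ∈ fib N M q then CfibW N M W a c m2 q p₀ p'' * (lapSym (fine N M) c m2 p'' : ℂ) else 0 := by
    simp_rw [mul_ite, mul_zero]
    rw [Finset.sum_ite_eq']
  have h2 : ∑ p ∈ fib N M q, CfibW N M W a c m2 q p₀ p
        * ((if q = red N M p'' then (a : ℂ) * conj (W p'') else 0) * W p)
      = (if q = red N M p'' then (a : ℂ) * conj (W p'') else 0)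
        * ∑ p ∈ fib N M q, CfibW N M W a c m2 q p₀ p * W p := by
    rw [Finset.mul_sum]
    exact Finset.sum_congr rfl fun p _ => by ring
  rw [h1, h2, sum_CfibW_mul_W N M W q hp₀]
  have hmem : p'' ∈ fib N M q ↔ q = red N M p'' := by
    rw [Finset.mem_filter]; simp [eq_comm]
  have hkS : (1 : ℂ) - (kapW N M W a c m2 q : ℂ) * (SfibW N M W c m2 q : ℂ)
      = ((1 + a * SfibW N M W c m2 q : ℝ) : ℂ)⁻¹ := by
    have := one_sub_kapW_mul N M W ha hc hm.le q
    rw [← Complex.ofReal_inv, ← this]; push_cast; ring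
  have hk : (kapW N M W a c m2 q : ℂ) * ((1 + a * SfibW N M W c m2 q : ℝ) : ℂ) = a := by
    exact_mod_cast kapW_mul N M W ha hc hm.le q
  have hpos : ((1 + a * SfibW N M W c m2 q : ℝ) : ℂ) ≠ 0 := by
    have hS := SfibW_nonneg N M W hc hm.le q
    exact_mod_cast (show (1 + a * SfibW N M W c m2 q : ℝ) ≠ 0 by positivity)
  by_cases hfib : q = red N M p''
  · rw [if_pos (hmem.mpr hfib), if_pos hfib]
    unfold CfibW
    have hσ₀ := hσ p₀
    have hσ'' := hσ p''
    by_cases he : p₀ = p''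
    · subst he
      rw [if_pos rfl, if_pos rfl, hkS]
      field_simp
      rw [← hk]
      ring
    · rw [if_neg he, if_neg he, hkS]
      field_simp
      rw [← hk]
      ring
  · rw [if_neg (fun h => hfib (hmem.mp h)), if_neg hfib]
    have hne : p₀ ≠ p'' := fun h => hfib (by rw [← hq, h])
    rw [if_neg hne]
    ring

/-- **THE MOMENTUM KERNEL OF `A_B⁻¹`** (covariant `B`, `m² > 0`): `(A_B⁻¹)^(p₀,p′) = |𝕋|·[red p′ = red p₀]·C_{red p₀}(p₀,p′)`
with the Sherman–Morrison blocks of the weight `w_B` — block diagonal over the alias fibres (from `A_B A_B⁻¹ = 1`,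
`hat_mul` and the left-inverse identity). [folklore] -/
theorem hat_covOp_inv {B : Matrix (Tor M) (Tor (fine N M)) ℝ} (hB : Covariant N M B) {a c m2 : ℝ} (ha : 0 ≤ a)
    (hc : 0 ≤ c) (hm : 0 < m2) (p₀ p' : Tor (fine N M)) :
    hat (fine N M) (covOp N M B a c m2)⁻¹ p₀ p'
      = (Fintype.card (Tor (fine N M)) : ℂ)
        * (if red N M p' = red N M p₀ then CfibW N M (wt N M B) a c m2 (red N M p₀) p₀ p' else 0) := by
  have hcard : (Fintype.card (Tor (fine N M)) : ℂ) ≠ 0 := by exact_mod_cast Fintype.card_ne_zero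
  have hunit : IsUnit (covOp N M B a c m2).det :=
    (Matrix.isUnit_iff_isUnit_det _).mp (covOp_isUnit N M B ha hc hm)
  have hAA : covOp N M B a c m2 * (covOp N M B a c m2)⁻¹ = 1 := Matrix.mul_nonsing_inv _ hunit
  have hstar : ∀ p : Tor (fine N M),
      ∑ p'', BfibW N M (wt N M B) a c m2 p p'' * hat (fine N M) (covOp N M B a c m2)⁻¹ p'' p'
        = if p = p' then (Fintype.card (Tor (fine N M)) : ℂ) else 0 := by
    intro p
    have h := hat_mul (fine N M) (covOp N M B a c m2) (covOp N M B a c m2)⁻¹ p p'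
    rw [hAA, hat_one] at h
    simp only [sub_eq_zero, hat_covOp N M hB] at h
    rw [h, Finset.mul_sum]
    refine Finset.sum_congr rfl fun p'' _ => ?_
    field_simp
  have hp₀ : p₀ ∈ fib N M (red N M p₀) := by simp
  have hsum := congrArg
    (fun f : Tor (fine N M) → ℂ => ∑ p ∈ fib N M (red N M p₀), CfibW N M (wt N M B) a c m2 (red N M p₀) p₀ p * f p)
    (funext hstar)
  have hL : ∑ p ∈ fib N M (red N M p₀), CfibW N M (wt N M B) a c m2 (red N M p₀) p₀ p
        * ∑ p'', BfibW N M (wt N M B) a c m2 p p'' * hat (fine N M) (covOp N M B a c m2)⁻¹ p'' p'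
      = hat (fine N M) (covOp N M B a c m2)⁻¹ p₀ p' := by
    simp_rw [Finset.mul_sum]
    rw [Finset.sum_comm]
    have : ∀ p'' : Tor (fine N M), ∑ p ∈ fib N M (red N M p₀),
        CfibW N M (wt N M B) a c m2 (red N M p₀) p₀ p
          * (BfibW N M (wt N M B) a c m2 p p'' * hat (fine N M) (covOp N M B a c m2)⁻¹ p'' p')
        = (if p₀ = p'' then 1 else 0) * hat (fine N M) (covOp N M B a c m2)⁻¹ p'' p' := by
      intro p''
      rw [← sum_CfibW_mul_BfibW N M (wt N M B) ha hc hm (red N M p₀) hp₀ p'', Finset.sum_mul]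
      exact Finset.sum_congr rfl fun p _ => by ring
    simp_rw [this, ite_mul, one_mul, zero_mul]
    rw [Finset.sum_ite_eq]
    simp
  have hR : ∑ p ∈ fib N M (red N M p₀), CfibW N M (wt N M B) a c m2 (red N M p₀) p₀ p
        * (if p = p' then (Fintype.card (Tor (fine N M)) : ℂ) else 0)
      = (Fintype.card (Tor (fine N M)) : ℂ)
        * (if red N M p' = red N M p₀ then CfibW N M (wt N M B) a c m2 (red N M p₀) p₀ p' else 0) := by
    simp_rw [mul_ite, mul_zero]
    rw [Finset.sum_ite_eq']
    simp only [Finset.mem_filter, Finset.mem_univ, true_and]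
    split_ifs <;> ring
  have hsum' : ∑ p ∈ fib N M (red N M p₀), CfibW N M (wt N M B) a c m2 (red N M p₀) p₀ p
        * ∑ p'', BfibW N M (wt N M B) a c m2 p p'' * hat (fine N M) (covOp N M B a c m2)⁻¹ p'' p'
      = ∑ p ∈ fib N M (red N M p₀), CfibW N M (wt N M B) a c m2 (red N M p₀) p₀ p
        * (if p = p' then (Fintype.card (Tor (fine N M)) : ℂ) else 0) := hsum
  rw [hL, hR] at hsum'
  exact hsum'

end Fibre

/-! ## §3 Admissible alias weights; the fibre amplitude `A^w_q(x)` and the per-fibre bound (any `d ≥ 1`, any periods) -/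

section Amplitude

variable (N : ℕ) [NeZero N] (M : Fin d → ℕ) [hM : ∀ μ, NeZero (M μ)]

/-- ADMISSIBILITY of an alias weight `w` (the three properties of King's `u` that the Woodbury certificate uses, with
room for one more bounded factor — e.g. Bałaban's contour factor `v_μ`, `|v_μ| ≤ 1`, `|v_μ| ≥ 2/π` at the central
alias): (W0) `w(0) = 1`; (W1) `|w(p)| ≤ |u(p)|`; (W2) `|w(z_q)| ≥ (2/π)^{d+1}` at the central alias `z_q` of every
fibre. [folklore] -/
structure Admissible (W : Tor (fine N M) → ℂ) : Prop where
  zero : W 0 = 1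
  dom : ∀ p, ‖W p‖ ≤ ‖u N M p‖
  cen : ∀ q, (2 / π) ^ (d + 1) ≤ ‖W (z N M q)‖

variable {N M} in
/-- (W1) ⟹ off the central alias the zero fibre carries no weight: `w(pOf(m,0)) = 0`, `m ≠ 0`. [folklore] -/
theorem Admissible.offCentre_zero {W : Tor (fine N M) → ℂ} (hW : Admissible N M W) (hN : 1 ≤ N)
    {m : Fin d → Fin N} (hm : m ≠ fun _ => 0) : W (pOf N M (m, 0)) = 0 := by
  have h := hW.dom (pOf N M (m, 0))
  rw [u_pOf_zero_eq_zero N M hN hm, norm_zero] at h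
  exact norm_eq_zero.mp (le_antisymm h (norm_nonneg _))

variable {N M} in
/-- (W2) ⟹ `|w(z_q)|² ≥ (4/π²)^{d+1} > 0`. [folklore] -/
theorem Admissible.cen_sq {W : Tor (fine N M) → ℂ} (hW : Admissible N M W) (q : Tor M) :
    (4 / π ^ 2) ^ (d + 1) ≤ ‖W (z N M q)‖ ^ 2 := by
  have e : (4 / π ^ 2) ^ (d + 1) = ((2 / π) ^ (d + 1)) ^ 2 := by
    rw [← pow_mul, mul_comm, pow_mul]; congr 1; ring
  rw [e]
  exact pow_le_pow_left₀ (by positivity) (hW.cen q) 2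

/-- King's own weight `u` is admissible (`(2/π)^{d+1} ≤ (2/π)^d ≤ |u(z_q)|`). [folklore] -/
theorem admissible_u (hN : 1 ≤ N) : Admissible N M (u N M) where
  zero := u_zero N M
  dom := fun _ => le_rfl
  cen := fun q => by
    have h1 : (2 / π) ^ (d + 1) ≤ (2 / π) ^ d := by
      rw [pow_succ]
      have hπ : 2 / π ≤ 1 := by
        rw [div_le_one Real.pi_pos]; linarith [Real.pi_gt_three]
      exact mul_le_of_le_one_right (by positivity) hπ
    exact h1.trans (norm_u_central_ge N M hN q)

/-- THE FIBRE AMPLITUDE of the weight `w`: `A^w_q(x) = Σ_{p ∈ fib q} e^{−ip·x} w(p)/σ(p)` (King scaling `c = N²`).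
[folklore] -/
def fampW (W : Tor (fine N M) → ℂ) (m2 : ℝ) (q : Tor M) (x : Tor (fine N M)) : ℂ :=
  ∑ p ∈ fib N M q, conj (chi (fine N M) p x) * (W p / (lapSym (fine N M) ((N : ℝ) ^ 2) m2 p : ℂ))

/-- THE PUNCTURED WOODBURY KERNEL of the weight `w`:
`R^⊥_w(x,x′) = |𝕋|⁻¹ Σ_{q ≠ 0} κ_w(q) A^w_q(x) conj A^w_q(x′)`. [folklore] -/
def RperpW (W : Tor (fine N M) → ℂ) (a m2 : ℝ) (x x' : Tor (fine N M)) : ℂ :=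
  ((Fintype.card (Tor (fine N M)) : ℂ))⁻¹ *
    ∑ q ∈ (Finset.univ : Finset (Tor M)).erase 0,
      (kapW N M W a ((N : ℝ) ^ 2) m2 q : ℂ) * fampW N M W m2 q x * conj (fampW N M W m2 q x')

/-- **(B1)** `|A^w_q(x)| ≤ |w(z_q)|/σ(z_q) + Y(q)` under (W1) (the off-centre aliases are dominated by King's). [folklore] -/
theorem norm_fampW_le {W : Tor (fine N M) → ℂ} (hdom : ∀ p, ‖W p‖ ≤ ‖u N M p‖) (hN : 1 ≤ N) {m2 : ℝ}
    (hm2 : 0 ≤ m2) (q : Tor M) (x : Tor (fine N M)) :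
    ‖fampW N M W m2 q x‖
      ≤ ‖W (z N M q)‖ / lapSym (fine N M) ((N : ℝ) ^ 2) m2 (z N M q) + Yoff N M m2 q := by
  have hσ0 : ∀ p, 0 ≤ lapSym (fine N M) ((N : ℝ) ^ 2) m2 p := fun p => lapSym_nonneg _ (by positivity) hm2 p
  have _h := hN
  unfold fampW Yoff
  calc ‖∑ p ∈ fib N M q, conj (chi (fine N M) p x) * (W p / (lapSym (fine N M) ((N : ℝ) ^ 2) m2 p : ℂ))‖
      ≤ ∑ p ∈ fib N M q, ‖conj (chi (fine N M) p x) * (W p / (lapSym (fine N M) ((N : ℝ) ^ 2) m2 p : ℂ))‖ :=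
        norm_sum_le _ _
    _ = ∑ p ∈ fib N M q, ‖W p‖ / lapSym (fine N M) ((N : ℝ) ^ 2) m2 p := by
        refine Finset.sum_congr rfl fun p _ => ?_
        rw [norm_mul, Complex.norm_conj, norm_chi, one_mul, norm_div, Complex.norm_real, Real.norm_eq_abs,
          abs_of_nonneg (hσ0 p)]
    _ = ∑ m : Fin d → Fin N, ‖W (pOf N M (m, q))‖ / lapSym (fine N M) ((N : ℝ) ^ 2) m2 (pOf N M (m, q)) :=
        sum_fib_eq_sum_pOf N M q _
    _ = ‖W (z N M q)‖ / lapSym (fine N M) ((N : ℝ) ^ 2) m2 (z N M q)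
          + ∑ m ∈ (Finset.univ : Finset (Fin d → Fin N)).erase (fun _ => 0),
              ‖W (pOf N M (m, q))‖ / lapSym (fine N M) ((N : ℝ) ^ 2) m2 (pOf N M (m, q)) := by
        rw [← Finset.add_sum_erase _ _ (Finset.mem_univ (fun _ => (0 : Fin N))), pOf_zero_eq_z]
    _ ≤ _ := add_le_add le_rfl
        (Finset.sum_le_sum fun m _ => div_le_div_of_nonneg_right (hdom _) (hσ0 _))

/-- **(B3)** `|w(z_q)|²/σ(z_q) ≤ S_w(q)`. [folklore] -/
theorem central_le_SfibW (W : Tor (fine N M) → ℂ) {m2 : ℝ} (hm2 : 0 ≤ m2) (q : Tor M) :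
    ‖W (z N M q)‖ ^ 2 / lapSym (fine N M) ((N : ℝ) ^ 2) m2 (z N M q) ≤ SfibW N M W ((N : ℝ) ^ 2) m2 q := by
  unfold SfibW
  exact Finset.single_le_sum (f := fun p => ‖W p‖ ^ 2 / lapSym (fine N M) ((N : ℝ) ^ 2) m2 p)
    (fun p _ => div_nonneg (sq_nonneg _) (lapSym_nonneg _ (by positivity) hm2 p)) (z_mem_fib N M q)

/-- **(B3′)** `κ_w(q) ≤ σ(z_q)/|w(z_q)|²` for `a > 0`, `q ≠ 0`, under (W2). [folklore] -/
theorem kapW_le {W : Tor (fine N M) → ℂ} (hW : Admissible N M W) (hN : 1 ≤ N) {a m2 : ℝ} (ha : 0 < a)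
    (hm2 : 0 ≤ m2) {q : Tor M} (hq : q ≠ 0) :
    kapW N M W a ((N : ℝ) ^ 2) m2 q
      ≤ lapSym (fine N M) ((N : ℝ) ^ 2) m2 (z N M q) / ‖W (z N M q)‖ ^ 2 := by
  have hσ := lapSym_z_pos N M hN hm2 hq
  have hu : 0 < ‖W (z N M q)‖ ^ 2 := lt_of_lt_of_le (by positivity) (hW.cen_sq q)
  have hS := central_le_SfibW N M W hm2 q
  have hS0 : 0 < SfibW N M W ((N : ℝ) ^ 2) m2 q := lt_of_lt_of_le (div_pos hu hσ) hS
  unfold kapW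
  calc a / (1 + a * SfibW N M W ((N : ℝ) ^ 2) m2 q) ≤ 1 / SfibW N M W ((N : ℝ) ^ 2) m2 q := by
        rw [div_le_div_iff₀ (by positivity) hS0]; nlinarith
    _ ≤ 1 / (‖W (z N M q)‖ ^ 2 / lapSym (fine N M) ((N : ℝ) ^ 2) m2 (z N M q)) :=
        one_div_le_one_div_of_le (div_pos hu hσ) hS
    _ = _ := by rw [one_div_div]

/-- **(B4) THE PER-FIBRE BOUND** for an admissible weight: for `q ≠ 0`, `a > 0`, `m² ≥ 0`, `N, d ≥ 1` and all `x, x′`,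
`‖κ_w(q) A^w_q(x) conj A^w_q(x′)‖ ≤ 2/σ(z_q) + 2·C_Y(d)²·(π²/4)^{d+1}·(dπ² + m²)`. [folklore] -/
theorem fibre_termW_le {W : Tor (fine N M) → ℂ} (hW : Admissible N M W) (hd : 0 < d) (hN : 1 ≤ N) {a m2 : ℝ}
    (ha : 0 < a) (hm2 : 0 ≤ m2) {q : Tor M} (hq : q ≠ 0) (x x' : Tor (fine N M)) :
    ‖(kapW N M W a ((N : ℝ) ^ 2) m2 q : ℂ) * fampW N M W m2 q x * conj (fampW N M W m2 q x')‖
      ≤ 2 / lapSym (fine N M) ((N : ℝ) ^ 2) m2 (z N M q)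
        + 2 * aliasC d ^ 2 * ((π ^ 2 / 4) ^ (d + 1) * (d * π ^ 2 + m2)) := by
  set σ₀ := lapSym (fine N M) ((N : ℝ) ^ 2) m2 (z N M q) with hσ₀
  set u₀ := ‖W (z N M q)‖ with hu₀
  set κ := kapW N M W a ((N : ℝ) ^ 2) m2 q with hκ
  set Y := Yoff N M m2 q with hY
  have hσ := lapSym_z_pos N M hN hm2 hq
  have hu2 : (4 / π ^ 2) ^ (d + 1) ≤ u₀ ^ 2 := hW.cen_sq q
  have hu : 0 < u₀ ^ 2 := lt_of_lt_of_le (by positivity) hu2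
  have hκ0 : 0 ≤ κ := kapW_nonneg N M W ha.le (by positivity) hm2 q
  have hκle : κ ≤ σ₀ / u₀ ^ 2 := kapW_le N M hW hN ha hm2 hq
  have hY0 : 0 ≤ Y := Yoff_nonneg N M hm2 q
  have hYC : Y ≤ aliasC d := Yoff_le N M hd hN hm2 q
  have hA := norm_fampW_le N M hW.dom hN hm2 q x
  have hA' := norm_fampW_le N M hW.dom hN hm2 q x'
  have hB0 : 0 ≤ u₀ / σ₀ + Y := by positivity
  have h1 : ‖(κ : ℂ) * fampW N M W m2 q x * conj (fampW N M W m2 q x')‖ ≤ κ * ((u₀ / σ₀ + Y) * (u₀ / σ₀ + Y)) := by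
    rw [norm_mul, norm_mul, Complex.norm_conj, Complex.norm_real, Real.norm_eq_abs, abs_of_nonneg hκ0, mul_assoc]
    exact mul_le_mul_of_nonneg_left (mul_le_mul hA hA' (norm_nonneg _) hB0) hκ0
  have h2 : (u₀ / σ₀ + Y) * (u₀ / σ₀ + Y) ≤ 2 * (u₀ / σ₀) ^ 2 + 2 * Y ^ 2 := by
    nlinarith [sq_nonneg (u₀ / σ₀ - Y)]
  have hu0 : u₀ ≠ 0 := by
    intro h0; rw [h0] at hu; simp at hu
  have h3 : κ * (u₀ / σ₀) ^ 2 ≤ 1 / σ₀ := by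
    calc κ * (u₀ / σ₀) ^ 2 ≤ σ₀ / u₀ ^ 2 * (u₀ / σ₀) ^ 2 := mul_le_mul_of_nonneg_right hκle (sq_nonneg _)
      _ = 1 / σ₀ := by field_simp
  have h4 : σ₀ / u₀ ^ 2 ≤ (π ^ 2 / 4) ^ (d + 1) * (d * π ^ 2 + m2) := by
    have hle := lapSym_z_le N M (m2 := m2) q
    rw [div_le_iff₀ hu]
    calc σ₀ ≤ d * π ^ 2 + m2 := hle
      _ = (π ^ 2 / 4) ^ (d + 1) * (d * π ^ 2 + m2) * (4 / π ^ 2) ^ (d + 1) := by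
          rw [mul_comm ((π ^ 2 / 4) ^ (d + 1)), mul_assoc, ← mul_pow]
          have : π ^ 2 / 4 * (4 / π ^ 2) = 1 := by field_simp
          rw [this, one_pow, mul_one]
      _ ≤ (π ^ 2 / 4) ^ (d + 1) * (d * π ^ 2 + m2) * u₀ ^ 2 := by
          have : 0 ≤ (π ^ 2 / 4) ^ (d + 1) * (d * π ^ 2 + m2) := by positivity
          exact mul_le_mul_of_nonneg_left hu2 this
  have h5 : κ * Y ^ 2 ≤ aliasC d ^ 2 * ((π ^ 2 / 4) ^ (d + 1) * (d * π ^ 2 + m2)) := by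
    have hY2 : Y ^ 2 ≤ aliasC d ^ 2 := pow_le_pow_left₀ hY0 hYC 2
    calc κ * Y ^ 2 ≤ (σ₀ / u₀ ^ 2) * aliasC d ^ 2 := mul_le_mul hκle hY2 (sq_nonneg _) (by positivity)
      _ ≤ ((π ^ 2 / 4) ^ (d + 1) * (d * π ^ 2 + m2)) * aliasC d ^ 2 :=
          mul_le_mul_of_nonneg_right h4 (sq_nonneg _)
      _ = _ := by ring
  calc ‖(κ : ℂ) * fampW N M W m2 q x * conj (fampW N M W m2 q x')‖
      ≤ κ * ((u₀ / σ₀ + Y) * (u₀ / σ₀ + Y)) := h1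
    _ ≤ κ * (2 * (u₀ / σ₀) ^ 2 + 2 * Y ^ 2) := mul_le_mul_of_nonneg_left h2 hκ0
    _ = 2 * (κ * (u₀ / σ₀) ^ 2) + 2 * (κ * Y ^ 2) := by ring
    _ ≤ 2 * (1 / σ₀) + 2 * (aliasC d ^ 2 * ((π ^ 2 / 4) ^ (d + 1) * (d * π ^ 2 + m2))) := by gcongr
    _ = _ := by ring

end Amplitude

/-! ## §4 The exact identification `A_B⁻¹ = G_free^⊥ + |𝕋|⁻¹(m²+a)⁻¹ − R^⊥_{w_B}` (kernel inversion of the fibre inverse) -/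

section Exact

variable (N : ℕ) [NeZero N] (M : Fin d → ℕ) [hM : ∀ μ, NeZero (M μ)]

/-- the zero-fibre amplitude of an admissible weight: `A^w_0(x) = 1/m²`. [folklore] -/
theorem fampW_zero {W : Tor (fine N M) → ℂ} (hW : Admissible N M W) (hN : 1 ≤ N) (m2 : ℝ) (x : Tor (fine N M)) :
    fampW N M W m2 0 x = 1 / (m2 : ℂ) := by
  unfold fampW
  rw [sum_fib_eq_sum_pOf, ← Finset.add_sum_erase _ _ (Finset.mem_univ (fun _ => (0 : Fin N))),
    pOf_zero_eq_z, z_zero, hW.zero, chi_zero_left, lapSym_zero, map_one, one_mul,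
    Finset.sum_eq_zero (fun m hm => by rw [hW.offCentre_zero hN (Finset.ne_of_mem_erase hm)]; simp), add_zero,
    one_div]

/-- the zero-fibre sum of an admissible weight: `S_w(0) = 1/m²`. [folklore] -/
theorem SfibW_zero {W : Tor (fine N M) → ℂ} (hW : Admissible N M W) (hN : 1 ≤ N) (m2 : ℝ) :
    SfibW N M W ((N : ℝ) ^ 2) m2 0 = 1 / m2 := by
  unfold SfibW
  rw [sum_fib_eq_sum_pOf, ← Finset.add_sum_erase _ _ (Finset.mem_univ (fun _ => (0 : Fin N))),
    pOf_zero_eq_z, z_zero, hW.zero, lapSym_zero, norm_one, one_pow,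
    Finset.sum_eq_zero (fun m hm => by rw [hW.offCentre_zero hN (Finset.ne_of_mem_erase hm)]; simp), add_zero]

/-- **THE EXACT DECOMPOSITION (P0) for a covariant averaging.**  `B` coarse-covariant with admissible weight `w_B`,
King scaling (`c = N²`), `a ≥ 0`, `m² > 0`, `N ≥ 1`:
`A_B⁻¹(x,x′) = G_free^⊥(x′−x) + |𝕋|⁻¹(m²+a)⁻¹ − R^⊥_{w_B}(x,x′)` — kernel inversion + the fibre inverse
`hat_covOp_inv` + the exactly evaluated zero fibre (`A^w_0 ≡ 1/m²`, `S_w(0) = 1/m²`, `κ_w(0) = am²/(m²+a)`).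
[folklore] -/
theorem covOp_inv_decomposition {B : Matrix (Tor M) (Tor (fine N M)) ℝ} (hB : Covariant N M B)
    (hW : Admissible N M (wt N M B)) (hN : 1 ≤ N) {a m2 : ℝ} (ha : 0 ≤ a) (hm : 0 < m2) (x x' : Tor (fine N M)) :
    (((covOp N M B a ((N : ℝ) ^ 2) m2)⁻¹ x x' : ℝ) : ℂ)
      = GfreePerp N M m2 (x' - x) + ((Fintype.card (Tor (fine N M)) : ℂ))⁻¹ * (1 / ((m2 : ℂ) + a))
          - RperpW N M (wt N M B) a m2 x x' := by
  set W := wt N M B with hWdef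
  set V : ℂ := (Fintype.card (Tor (fine N M)) : ℂ) with hV
  have hV0 : V ≠ 0 := by rw [hV]; exact_mod_cast Fintype.card_ne_zero
  have hm0 : (m2 : ℂ) ≠ 0 := by exact_mod_cast hm.ne'
  have hma : (m2 : ℂ) + a ≠ 0 := by
    have : (0 : ℝ) < m2 + a := by linarith
    exact_mod_cast this.ne'
  set σ : Tor (fine N M) → ℝ := fun p => lapSym (fine N M) ((N : ℝ) ^ 2) m2 p with hσdef
  have hinv := kernel_inversion (fine N M) (covOp N M B a ((N : ℝ) ^ 2) m2)⁻¹ x x'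
  have hhat : ∀ p p', hat (fine N M) (covOp N M B a ((N : ℝ) ^ 2) m2)⁻¹ p p'
      = V * (if red N M p' = red N M p then CfibW N M W a ((N : ℝ) ^ 2) m2 (red N M p) p p' else 0) :=
    fun p p' => hat_covOp_inv N M hB ha (by positivity) hm p p'
  simp_rw [hhat] at hinv
  have hsplit : ∑ p, ∑ p', conj (chi (fine N M) p x)
        * (V * (if red N M p' = red N M p then CfibW N M W a ((N : ℝ) ^ 2) m2 (red N M p) p p' else 0))
        * chi (fine N M) p' x'
      = V * (∑ p, conj (chi (fine N M) p x) * chi (fine N M) p x' / (σ p : ℂ))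
        - V * ∑ p, ∑ p', (if red N M p' = red N M p then
            (kapW N M W a ((N : ℝ) ^ 2) m2 (red N M p) : ℂ)
              * (conj (chi (fine N M) p x) * (W p / (σ p : ℂ)))
              * (conj (W p') / (σ p' : ℂ) * chi (fine N M) p' x') else 0) := by
    rw [Finset.mul_sum, Finset.mul_sum, ← Finset.sum_sub_distrib]
    refine Finset.sum_congr rfl fun p _ => ?_
    have hdiag : V * (conj (chi (fine N M) p x) * chi (fine N M) p x' / (σ p : ℂ))
        = ∑ p', (if p' = p then V * (conj (chi (fine N M) p x) * chi (fine N M) p x' / (σ p : ℂ)) else 0) := by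
      rw [Finset.sum_ite_eq' Finset.univ p, if_pos (Finset.mem_univ p)]
    rw [hdiag, Finset.mul_sum, ← Finset.sum_sub_distrib]
    refine Finset.sum_congr rfl fun p' _ => ?_
    by_cases hr : red N M p' = red N M p
    · rw [if_pos hr, if_pos hr]
      unfold CfibW
      by_cases hpp : p' = p
      · subst hpp
        rw [if_pos rfl, if_pos rfl]
        simp only [hσdef]
        ring
      · rw [if_neg hpp, if_neg (Ne.symm hpp)]
        simp only [hσdef]
        ring
    · rw [if_neg hr, if_neg hr]
      have hpp : p' ≠ p := fun h => hr (by rw [h])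
      rw [if_neg hpp]
      ring
  rw [hsplit] at hinv
  have hfree : ∑ p, conj (chi (fine N M) p x) * chi (fine N M) p x' / (σ p : ℂ)
      = 1 / (m2 : ℂ) + V * GfreePerp N M m2 (x' - x) := by
    unfold GfreePerp
    rw [← mul_assoc, ← hV, mul_inv_cancel₀ hV0, one_mul,
      ← Finset.add_sum_erase _ _ (Finset.mem_univ (0 : Tor (fine N M)))]
    congr 1
    · rw [chi_zero_left, chi_zero_left, map_one]
      simp only [hσdef]
      rw [lapSym_zero]; ring
    · refine Finset.sum_congr rfl fun p _ => ?_
      rw [conj_chi_mul_chi]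
  have hrank : ∑ p, ∑ p', (if red N M p' = red N M p then
        (kapW N M W a ((N : ℝ) ^ 2) m2 (red N M p) : ℂ)
          * (conj (chi (fine N M) p x) * (W p / (σ p : ℂ)))
          * (conj (W p') / (σ p' : ℂ) * chi (fine N M) p' x') else 0)
      = ∑ q, (kapW N M W a ((N : ℝ) ^ 2) m2 q : ℂ) * fampW N M W m2 q x * conj (fampW N M W m2 q x') := by
    rw [sum_red_pair N M (fun q => (kapW N M W a ((N : ℝ) ^ 2) m2 q : ℂ))
      (fun p => conj (chi (fine N M) p x) * (W p / (σ p : ℂ)))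
      (fun p' => conj (W p') / (σ p' : ℂ) * chi (fine N M) p' x')]
    refine Finset.sum_congr rfl fun q _ => ?_
    unfold fampW
    rw [map_sum]
    congr 1
    refine Finset.sum_congr rfl fun p' _ => ?_
    rw [map_mul, map_div₀, Complex.conj_conj, Complex.conj_ofReal]
    simp only [hσdef]
    ring
  rw [hfree, hrank, ← Finset.add_sum_erase _ _ (Finset.mem_univ (0 : Tor M)), fampW_zero N M hW hN,
    fampW_zero N M hW hN] at hinv
  have hk0 : (kapW N M W a ((N : ℝ) ^ 2) m2 0 : ℂ) = (a : ℂ) * m2 / ((m2 : ℂ) + a) := by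
    unfold kapW
    rw [SfibW_zero N M hW hN]
    have : (1 : ℝ) + a * (1 / m2) = (m2 + a) / m2 := by field_simp
    rw [this]
    push_cast
    field_simp
  rw [hk0] at hinv
  have hR : ∑ q ∈ Finset.univ.erase (0 : Tor M),
        (kapW N M W a ((N : ℝ) ^ 2) m2 q : ℂ) * fampW N M W m2 q x * conj (fampW N M W m2 q x')
      = V * RperpW N M W a m2 x x' := by
    unfold RperpW
    rw [← mul_assoc, ← hV, mul_inv_cancel₀ hV0, one_mul]
  rw [hR] at hinv
  have hVV : V ^ 2 ≠ 0 := pow_ne_zero 2 hV0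
  apply mul_left_cancel₀ hVV
  rw [← hinv]
  rw [map_div₀, map_one, Complex.conj_ofReal]
  field_simp
  ring

end Exact

/-! ## §5 `d = 4`, equal periods: the volume-uniform `O(N⁻⁴)` bound on `R^⊥_w` for every admissible weight -/

section Four

variable (N M₀ : ℕ) [NeZero N] [NeZero M₀]

/-- the volume-uniform constant `Dᶜ(m²) = 5/2 + 2·600²·(π²/4)⁵·(4π² + m²)` (one factor `π²/4` more than the site model's
`woodburyD`, from (W2)'s exponent `d + 1`). [folklore] -/
def woodburyDc (m2 : ℝ) : ℝ := 5 / 2 + 2 * (600 : ℝ) ^ 2 * ((π ^ 2 / 4) ^ 5 * (4 * π ^ 2 + m2))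

/-- **MAIN BOUND (d = 4, equal periods, King scaling) for an admissible weight.**  On `𝕋 = (ℤ/NM₀)⁴`, block side
`N ≥ 1`, `a > 0`, `m² ≥ 0`: `‖R^⊥_w(x,x′)‖ ≤ Dᶜ(m²)/N⁴` for ALL `x, x′`, uniformly in the volume `M₀` and in `a`.
[folklore] -/
theorem norm_RperpW_le {W : Tor (fine N (cM M₀)) → ℂ} (hW : Admissible N (cM M₀) W) (hN : 1 ≤ N) {a m2 : ℝ}
    (ha : 0 < a) (hm2 : 0 ≤ m2) (x x' : Tor (fine N (cM M₀))) :
    ‖RperpW N (cM M₀) W a m2 x x'‖ ≤ woodburyDc m2 / (N : ℝ) ^ 4 := by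
  have hM : (0 : ℝ) < M₀ := by exact_mod_cast Nat.pos_of_ne_zero (NeZero.ne M₀)
  have hNr : (0 : ℝ) < N := by exact_mod_cast (show 0 < N by omega)
  have hcard := card_tor_fine N M₀
  have hcardC : ((Fintype.card (Tor (fine N (cM M₀))) : ℂ)) = (((N : ℝ) ^ 4 * (M₀ : ℝ) ^ 4 : ℝ) : ℂ) := by
    rw [← hcard]; push_cast; rfl
  set B := (π ^ 2 / 4) ^ (4 + 1) * (4 * π ^ 2 + m2) with hB
  have hB0 : 0 ≤ B := by positivity
  have hsum : ∑ q ∈ (Finset.univ : Finset (Tor (cM M₀))).erase 0,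
      ‖(kapW N (cM M₀) W a ((N : ℝ) ^ 2) m2 q : ℂ) * fampW N (cM M₀) W m2 q x * conj (fampW N (cM M₀) W m2 q x')‖
        ≤ (5 / 2) * (M₀ : ℝ) ^ 4 + (M₀ : ℝ) ^ 4 * (2 * aliasC 4 ^ 2 * B) := by
    have hcnt := card_erase_zero_le M₀
    calc ∑ q ∈ (Finset.univ : Finset (Tor (cM M₀))).erase 0,
          ‖(kapW N (cM M₀) W a ((N : ℝ) ^ 2) m2 q : ℂ) * fampW N (cM M₀) W m2 q x * conj (fampW N (cM M₀) W m2 q x')‖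
        ≤ ∑ q ∈ (Finset.univ : Finset (Tor (cM M₀))).erase 0,
            (2 / lapSym (fine N (cM M₀)) ((N : ℝ) ^ 2) m2 (z N (cM M₀) q) + 2 * aliasC 4 ^ 2 * B) := by
          refine Finset.sum_le_sum fun q hq => ?_
          have h := fibre_termW_le N (cM M₀) hW (by norm_num) hN ha hm2 (Finset.ne_of_mem_erase hq) x x'
          simpa [hB] using h
      _ = 2 * ∑ q ∈ (Finset.univ : Finset (Tor (cM M₀))).erase 0,
            1 / lapSym (fine N (cM M₀)) ((N : ℝ) ^ 2) m2 (z N (cM M₀) q)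
          + (((Finset.univ : Finset (Tor (cM M₀))).erase 0).card : ℝ) * (2 * aliasC 4 ^ 2 * B) := by
          rw [Finset.sum_add_distrib, Finset.sum_const, nsmul_eq_mul, Finset.mul_sum]
          congr 1
          exact Finset.sum_congr rfl fun q _ => by ring
      _ ≤ 2 * ((5 / 4) * (M₀ : ℝ) ^ 4) + (M₀ : ℝ) ^ 4 * (2 * aliasC 4 ^ 2 * B) := by
          gcongr
          · exact sum_inv_lapSym_z_le N M₀ hN hm2
      _ = _ := by ring
  unfold RperpW
  rw [norm_mul, norm_inv, hcardC, Complex.norm_real, Real.norm_eq_abs, abs_of_pos (by positivity)]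
  calc ((N : ℝ) ^ 4 * (M₀ : ℝ) ^ 4)⁻¹ *
        ‖∑ q ∈ (Finset.univ : Finset (Tor (cM M₀))).erase 0,
          (kapW N (cM M₀) W a ((N : ℝ) ^ 2) m2 q : ℂ) * fampW N (cM M₀) W m2 q x * conj (fampW N (cM M₀) W m2 q x')‖
      ≤ ((N : ℝ) ^ 4 * (M₀ : ℝ) ^ 4)⁻¹ * ((5 / 2) * (M₀ : ℝ) ^ 4 + (M₀ : ℝ) ^ 4 * (2 * aliasC 4 ^ 2 * B)) := by
        refine mul_le_mul_of_nonneg_left ((norm_sum_le _ _).trans hsum) (by positivity)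
    _ = woodburyDc m2 / (N : ℝ) ^ 4 := by
        rw [woodburyDc, aliasC_four, hB]
        field_simp
        ring

end Four

/-! ## §6 Differenced kernels: `∇_x R^⊥_w = O(N⁻⁵)`, `∇_x∇_{x′} R^⊥_w = O(N⁻⁶)` (each lattice difference gains `N⁻¹`) -/

section Diff

variable (N : ℕ) [NeZero N] (M : Fin d → ℕ) [hM : ∀ μ, NeZero (M μ)]

/-- THE DIFFERENCED FIBRE AMPLITUDE `∇_μ A^w_q(x) = A^w_q(x + e_μ) − A^w_q(x)`. [folklore] -/
def dfampW (W : Tor (fine N M) → ℂ) (m2 : ℝ) (q : Tor M) (μ : Fin d) (x : Tor (fine N M)) : ℂ :=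
  fampW N M W m2 q (x + unitVec (fine N M) μ) - fampW N M W m2 q x

/-- **(B1′)** `|∇_μ A^w_q(x)| ≤ (|w(z_q)|/√σ(z_q) + Y₂(q))/N` under (W1). [folklore] -/
theorem norm_dfampW_le {W : Tor (fine N M) → ℂ} (hdom : ∀ p, ‖W p‖ ≤ ‖u N M p‖) (hN : 1 ≤ N) {m2 : ℝ}
    (hm2 : 0 ≤ m2) (q : Tor M) (μ : Fin d) (x : Tor (fine N M)) :
    ‖dfampW N M W m2 q μ x‖
      ≤ (‖W (z N M q)‖ / Real.sqrt (lapSym (fine N M) ((N : ℝ) ^ 2) m2 (z N M q)) + Yoff2 N M m2 q) / N := by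
  have hNr : (0 : ℝ) < N := by exact_mod_cast (show 0 < N by omega)
  have hσ0 : ∀ p, 0 ≤ lapSym (fine N M) ((N : ℝ) ^ 2) m2 p := fun p => lapSym_nonneg _ (by positivity) hm2 p
  set e := unitVec (fine N M) μ with he
  have hexp : dfampW N M W m2 q μ x = ∑ p ∈ fib N M q,
      conj (chi (fine N M) p x) * (conj (chi (fine N M) p e) - 1)
        * (W p / (lapSym (fine N M) ((N : ℝ) ^ 2) m2 p : ℂ)) := by
    unfold dfampW fampW
    rw [← Finset.sum_sub_distrib]
    refine Finset.sum_congr rfl fun p _ => ?_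
    rw [chi_add_right, map_mul]
    ring
  rw [hexp]
  calc ‖∑ p ∈ fib N M q, conj (chi (fine N M) p x) * (conj (chi (fine N M) p e) - 1)
          * (W p / (lapSym (fine N M) ((N : ℝ) ^ 2) m2 p : ℂ))‖
      ≤ ∑ p ∈ fib N M q, ‖conj (chi (fine N M) p x) * (conj (chi (fine N M) p e) - 1)
          * (W p / (lapSym (fine N M) ((N : ℝ) ^ 2) m2 p : ℂ))‖ := norm_sum_le _ _
    _ ≤ ∑ p ∈ fib N M q, (Real.sqrt (lapSym (fine N M) ((N : ℝ) ^ 2) m2 p) / N)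
          * (‖W p‖ / lapSym (fine N M) ((N : ℝ) ^ 2) m2 p) := by
        refine Finset.sum_le_sum fun p _ => ?_
        rw [norm_mul, norm_mul, Complex.norm_conj, norm_chi, one_mul, norm_div, Complex.norm_real,
          Real.norm_eq_abs, abs_of_nonneg (hσ0 p)]
        refine mul_le_mul_of_nonneg_right ?_ (div_nonneg (norm_nonneg _) (hσ0 p))
        have h := norm_chi_unitVec_sub_one_le N M hm2 p μ
        rwa [← Complex.norm_conj, map_sub, map_one] at h
    _ = (∑ p ∈ fib N M q, ‖W p‖ / Real.sqrt (lapSym (fine N M) ((N : ℝ) ^ 2) m2 p)) / N := by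
        rw [Finset.sum_div]
        refine Finset.sum_congr rfl fun p _ => ?_
        by_cases h0 : lapSym (fine N M) ((N : ℝ) ^ 2) m2 p = 0
        · rw [h0]; simp
        · have hpos : 0 < lapSym (fine N M) ((N : ℝ) ^ 2) m2 p := lt_of_le_of_ne (hσ0 p) (Ne.symm h0)
          have hs : Real.sqrt (lapSym (fine N M) ((N : ℝ) ^ 2) m2 p) ≠ 0 := (Real.sqrt_pos.mpr hpos).ne'
          rw [div_mul_div_comm, div_div, div_eq_div_iff (mul_ne_zero hNr.ne' hpos.ne') (mul_ne_zero hs hNr.ne')]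
          linear_combination (‖W p‖ * (N : ℝ)) * Real.sq_sqrt hpos.le
    _ = (‖W (z N M q)‖ / Real.sqrt (lapSym (fine N M) ((N : ℝ) ^ 2) m2 (z N M q))
          + ∑ m ∈ (Finset.univ : Finset (Fin d → Fin N)).erase (fun _ => 0),
              ‖W (pOf N M (m, q))‖ / Real.sqrt (lapSym (fine N M) ((N : ℝ) ^ 2) m2 (pOf N M (m, q)))) / N := by
        rw [sum_fib_eq_sum_pOf N M q _, ← Finset.add_sum_erase _ _ (Finset.mem_univ (fun _ => (0 : Fin N))),
          pOf_zero_eq_z]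
    _ ≤ _ := by
        unfold Yoff2
        exact div_le_div_of_nonneg_right (add_le_add le_rfl
          (Finset.sum_le_sum fun m _ => div_le_div_of_nonneg_right (hdom _) (Real.sqrt_nonneg _))) hNr.le

/-- the mixed-term constant `E₁ᶜ(d, m²)` (the site model's `mixedE` with `(π/2)^{d+1}` in place of `(π/2)^d`). [folklore] -/
def mixedEc (d : ℕ) (m2 : ℝ) : ℝ :=
  (π / 2) ^ (d + 1) * ((1 + (d * π ^ 2 + m2)) / 2 * aliasC d + aliasC2 d)
    + ((π / 2) ^ (d + 1)) ^ 2 * (d * π ^ 2 + m2) * aliasC d * aliasC2 d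

/-- the double-difference constant `E₂ᶜ(d, m²)`. [folklore] -/
def doubleEc (d : ℕ) (m2 : ℝ) : ℝ :=
  1 + (1 + (d * π ^ 2 + m2)) * (π / 2) ^ (d + 1) * aliasC2 d
    + (d * π ^ 2 + m2) * ((π / 2) ^ (d + 1)) ^ 2 * aliasC2 d ^ 2

/-- `E₁ᶜ ≥ 0` (`m² ≥ 0`). [folklore] -/
theorem mixedEc_nonneg (d : ℕ) {m2 : ℝ} (hm2 : 0 ≤ m2) : 0 ≤ mixedEc d m2 := by
  have := aliasC_nonneg d; have := aliasC2_nonneg d; unfold mixedEc; positivity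

/-- `E₂ᶜ ≥ 0` (`m² ≥ 0`). [folklore] -/
theorem doubleEc_nonneg (d : ℕ) {m2 : ℝ} (hm2 : 0 ≤ m2) : 0 ≤ doubleEc d m2 := by
  have := aliasC2_nonneg d; unfold doubleEc; positivity

/-- **(B4′) THE MIXED PER-FIBRE BOUND**: `‖κ_w(q) ∇_μA^w_q(x) conj A^w_q(x′)‖ ≤ (1/√σ(z_q) + E₁ᶜ)/N` for `q ≠ 0`.
[folklore] -/
theorem mixed_termW_le {W : Tor (fine N M) → ℂ} (hW : Admissible N M W) (hd : 0 < d) (hN : 1 ≤ N) {a m2 : ℝ}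
    (ha : 0 < a) (hm2 : 0 ≤ m2) {q : Tor M} (hq : q ≠ 0) (μ : Fin d) (x x' : Tor (fine N M)) :
    ‖(kapW N M W a ((N : ℝ) ^ 2) m2 q : ℂ) * dfampW N M W m2 q μ x * conj (fampW N M W m2 q x')‖
      ≤ (1 / Real.sqrt (lapSym (fine N M) ((N : ℝ) ^ 2) m2 (z N M q)) + mixedEc d m2) / N := by
  have hNr : (0 : ℝ) < N := by exact_mod_cast (show 0 < N by omega)
  set S := lapSym (fine N M) ((N : ℝ) ^ 2) m2 (z N M q) with hS
  set A := ‖W (z N M q)‖ with hA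
  set κ := kapW N M W a ((N : ℝ) ^ 2) m2 q with hκ
  set Y := Yoff N M m2 q with hY
  set Y₂ := Yoff2 N M m2 q with hY₂
  set t := Real.sqrt S with ht
  have hSpos : 0 < S := lapSym_z_pos N M hN hm2 hq
  have htpos : 0 < t := Real.sqrt_pos.mpr hSpos
  have htS : t * t = S := Real.mul_self_sqrt hSpos.le
  have hc0 : 0 < (2 / π) ^ (d + 1) := by positivity
  have hAge : (2 / π) ^ (d + 1) ≤ A := hW.cen q
  have hApos : 0 < A := lt_of_lt_of_le hc0 hAge
  have hAinv : A⁻¹ ≤ (π / 2) ^ (d + 1) := by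
    have := inv_anti₀ hc0 hAge
    rwa [← inv_pow, inv_div] at this
  have hκ0 : 0 ≤ κ := kapW_nonneg N M W ha.le (by positivity) hm2 q
  have hκle : κ ≤ S / A ^ 2 := kapW_le N M hW hN ha hm2 hq
  have hY0 : 0 ≤ Y := Yoff_nonneg N M hm2 q
  have hYC : Y ≤ aliasC d := Yoff_le N M hd hN hm2 q
  have hY20 : 0 ≤ Y₂ := Yoff2_nonneg N M m2 q
  have hY2C : Y₂ ≤ aliasC2 d := Yoff2_le N M hd hN hm2 q
  have hSle : S ≤ d * π ^ 2 + m2 := lapSym_z_le N M q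
  have hC0 : 0 ≤ aliasC d := aliasC_nonneg d
  have hC20 : 0 ≤ aliasC2 d := aliasC2_nonneg d
  have htle : t ≤ (1 + (d * π ^ 2 + m2)) / 2 := by nlinarith [sq_nonneg (t - 1)]
  have hA1 : ‖dfampW N M W m2 q μ x‖ ≤ (A / t + Y₂) / N := norm_dfampW_le N M hW.dom hN hm2 q μ x
  have hA0 : ‖fampW N M W m2 q x'‖ ≤ A / S + Y := norm_fampW_le N M hW.dom hN hm2 q x'
  have hΦ1 : 0 ≤ (A / t + Y₂) / N := by positivity
  have hΦ0 : 0 ≤ A / S + Y := by positivity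
  have h1 : ‖(κ : ℂ) * dfampW N M W m2 q μ x * conj (fampW N M W m2 q x')‖
      ≤ κ * (((A / t + Y₂) / N) * (A / S + Y)) := by
    rw [norm_mul, norm_mul, Complex.norm_conj, Complex.norm_real, Real.norm_eq_abs, abs_of_nonneg hκ0, mul_assoc]
    exact mul_le_mul_of_nonneg_left (mul_le_mul hA1 hA0 (norm_nonneg _) hΦ1) hκ0
  have h2 : κ * (((A / t + Y₂) / N) * (A / S + Y)) ≤ S / A ^ 2 * (((A / t + Y₂) / N) * (A / S + Y)) :=
    mul_le_mul_of_nonneg_right hκle (by positivity)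
  have h3 : S / A ^ 2 * (((A / t + Y₂) / N) * (A / S + Y))
      = (1 / t + (t * Y * A⁻¹ + Y₂ * A⁻¹ + S * Y * Y₂ * A⁻¹ ^ 2)) / N := by
    rw [← htS]
    field_simp
    ring
  have hb1 : t * Y * A⁻¹ ≤ (1 + (d * π ^ 2 + m2)) / 2 * aliasC d * (π / 2) ^ (d + 1) :=
    mul_le_mul (mul_le_mul htle hYC hY0 (by positivity)) hAinv (by positivity) (by positivity)
  have hb2 : Y₂ * A⁻¹ ≤ aliasC2 d * (π / 2) ^ (d + 1) := mul_le_mul hY2C hAinv (by positivity) (by positivity)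
  have hb3 : S * Y * Y₂ * A⁻¹ ^ 2 ≤ (d * π ^ 2 + m2) * aliasC d * aliasC2 d * ((π / 2) ^ (d + 1)) ^ 2 := by
    have := pow_le_pow_left₀ (by positivity) hAinv 2
    exact mul_le_mul (mul_le_mul (mul_le_mul hSle hYC hY0 (by positivity)) hY2C hY20 (by positivity)) this
      (by positivity) (by positivity)
  have hE : t * Y * A⁻¹ + Y₂ * A⁻¹ + S * Y * Y₂ * A⁻¹ ^ 2 ≤ mixedEc d m2 := by
    unfold mixedEc; nlinarith
  calc ‖(κ : ℂ) * dfampW N M W m2 q μ x * conj (fampW N M W m2 q x')‖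
      ≤ (1 / t + (t * Y * A⁻¹ + Y₂ * A⁻¹ + S * Y * Y₂ * A⁻¹ ^ 2)) / N := by rw [← h3]; exact h1.trans h2
    _ ≤ (1 / t + mixedEc d m2) / N := by gcongr

/-- **(B4″) THE DOUBLE-DIFFERENCE PER-FIBRE BOUND**: `‖κ_w(q) ∇_μA^w_q(x) conj ∇_νA^w_q(x′)‖ ≤ E₂ᶜ/N²` for `q ≠ 0`.
[folklore] -/
theorem double_termW_le {W : Tor (fine N M) → ℂ} (hW : Admissible N M W) (hd : 0 < d) (hN : 1 ≤ N) {a m2 : ℝ}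
    (ha : 0 < a) (hm2 : 0 ≤ m2) {q : Tor M} (hq : q ≠ 0) (μ ν : Fin d) (x x' : Tor (fine N M)) :
    ‖(kapW N M W a ((N : ℝ) ^ 2) m2 q : ℂ) * dfampW N M W m2 q μ x * conj (dfampW N M W m2 q ν x')‖
      ≤ doubleEc d m2 / (N : ℝ) ^ 2 := by
  have hNr : (0 : ℝ) < N := by exact_mod_cast (show 0 < N by omega)
  set S := lapSym (fine N M) ((N : ℝ) ^ 2) m2 (z N M q) with hS
  set A := ‖W (z N M q)‖ with hA
  set κ := kapW N M W a ((N : ℝ) ^ 2) m2 q with hκ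
  set Y₂ := Yoff2 N M m2 q with hY₂
  set t := Real.sqrt S with ht
  have hSpos : 0 < S := lapSym_z_pos N M hN hm2 hq
  have htpos : 0 < t := Real.sqrt_pos.mpr hSpos
  have htS : t * t = S := Real.mul_self_sqrt hSpos.le
  have hc0 : 0 < (2 / π) ^ (d + 1) := by positivity
  have hAge : (2 / π) ^ (d + 1) ≤ A := hW.cen q
  have hApos : 0 < A := lt_of_lt_of_le hc0 hAge
  have hAinv : A⁻¹ ≤ (π / 2) ^ (d + 1) := by
    have := inv_anti₀ hc0 hAge
    rwa [← inv_pow, inv_div] at this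
  have hκ0 : 0 ≤ κ := kapW_nonneg N M W ha.le (by positivity) hm2 q
  have hκle : κ ≤ S / A ^ 2 := kapW_le N M hW hN ha hm2 hq
  have hY20 : 0 ≤ Y₂ := Yoff2_nonneg N M m2 q
  have hY2C : Y₂ ≤ aliasC2 d := Yoff2_le N M hd hN hm2 q
  have hSle : S ≤ d * π ^ 2 + m2 := lapSym_z_le N M q
  have hC20 : 0 ≤ aliasC2 d := aliasC2_nonneg d
  have h2t : 2 * t ≤ 1 + (d * π ^ 2 + m2) := by nlinarith [sq_nonneg (t - 1)]
  have hA1 : ‖dfampW N M W m2 q μ x‖ ≤ (A / t + Y₂) / N := norm_dfampW_le N M hW.dom hN hm2 q μ x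
  have hA1' : ‖dfampW N M W m2 q ν x'‖ ≤ (A / t + Y₂) / N := norm_dfampW_le N M hW.dom hN hm2 q ν x'
  have hΦ1 : 0 ≤ (A / t + Y₂) / N := by positivity
  have h1 : ‖(κ : ℂ) * dfampW N M W m2 q μ x * conj (dfampW N M W m2 q ν x')‖
      ≤ κ * (((A / t + Y₂) / N) * ((A / t + Y₂) / N)) := by
    rw [norm_mul, norm_mul, Complex.norm_conj, Complex.norm_real, Real.norm_eq_abs, abs_of_nonneg hκ0, mul_assoc]
    exact mul_le_mul_of_nonneg_left (mul_le_mul hA1 hA1' (norm_nonneg _) hΦ1) hκ0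
  have h2 : κ * (((A / t + Y₂) / N) * ((A / t + Y₂) / N))
      ≤ S / A ^ 2 * (((A / t + Y₂) / N) * ((A / t + Y₂) / N)) :=
    mul_le_mul_of_nonneg_right hκle (by positivity)
  have h3 : S / A ^ 2 * (((A / t + Y₂) / N) * ((A / t + Y₂) / N))
      = (1 + (2 * t * (Y₂ * A⁻¹) + S * (Y₂ * A⁻¹) ^ 2)) / (N : ℝ) ^ 2 := by
    rw [← htS]
    field_simp
    ring
  have hb2 : Y₂ * A⁻¹ ≤ aliasC2 d * (π / 2) ^ (d + 1) := mul_le_mul hY2C hAinv (by positivity) (by positivity)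
  have hb0 : 0 ≤ Y₂ * A⁻¹ := by positivity
  have hE : 2 * t * (Y₂ * A⁻¹) + S * (Y₂ * A⁻¹) ^ 2 ≤ doubleEc d m2 - 1 := by
    unfold doubleEc
    have hsq : (Y₂ * A⁻¹) ^ 2 ≤ (aliasC2 d * (π / 2) ^ (d + 1)) ^ 2 := pow_le_pow_left₀ hb0 hb2 2
    nlinarith [mul_le_mul h2t hb2 hb0 (by positivity), mul_le_mul hSle hsq (by positivity) (by positivity)]
  calc ‖(κ : ℂ) * dfampW N M W m2 q μ x * conj (dfampW N M W m2 q ν x')‖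
      ≤ (1 + (2 * t * (Y₂ * A⁻¹) + S * (Y₂ * A⁻¹) ^ 2)) / (N : ℝ) ^ 2 := by rw [← h3]; exact h1.trans h2
    _ ≤ (1 + (doubleEc d m2 - 1)) / (N : ℝ) ^ 2 := by gcongr
    _ = doubleEc d m2 / (N : ℝ) ^ 2 := by ring

/-- THE DIFFERENCED KERNELS `∇_μ^x R^⊥_w` and `∇_μ^x ∇_ν^{x′} R^⊥_w` (literal lattice differences). [folklore] -/
def dRperpW (W : Tor (fine N M) → ℂ) (a m2 : ℝ) (μ : Fin d) (x x' : Tor (fine N M)) : ℂ :=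
  RperpW N M W a m2 (x + unitVec (fine N M) μ) x' - RperpW N M W a m2 x x'

/-- see `dRperpW`. [folklore] -/
def ddRperpW (W : Tor (fine N M) → ℂ) (a m2 : ℝ) (μ ν : Fin d) (x x' : Tor (fine N M)) : ℂ :=
  RperpW N M W a m2 (x + unitVec (fine N M) μ) (x' + unitVec (fine N M) ν)
    - RperpW N M W a m2 (x + unitVec (fine N M) μ) x'
    - RperpW N M W a m2 x (x' + unitVec (fine N M) ν) + RperpW N M W a m2 x x'

/-- `∇_μ^x R^⊥_w` as the fibre sum `V⁻¹ Σ_{q≠0} κ_w(q) ∇_μA^w_q(x) conj A^w_q(x′)`. [folklore] -/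
theorem dRperpW_eq (W : Tor (fine N M) → ℂ) (a m2 : ℝ) (μ : Fin d) (x x' : Tor (fine N M)) :
    dRperpW N M W a m2 μ x x' = ((Fintype.card (Tor (fine N M)) : ℂ))⁻¹ *
      ∑ q ∈ (Finset.univ : Finset (Tor M)).erase 0,
        (kapW N M W a ((N : ℝ) ^ 2) m2 q : ℂ) * dfampW N M W m2 q μ x * conj (fampW N M W m2 q x') := by
  unfold dRperpW RperpW dfampW
  rw [← mul_sub, ← Finset.sum_sub_distrib]
  congr 1
  exact Finset.sum_congr rfl fun q _ => by ring

/-- `∇_μ^x∇_ν^{x′} R^⊥_w` as the fibre sum `V⁻¹ Σ_{q≠0} κ_w(q) ∇_μA^w_q(x) conj ∇_νA^w_q(x′)`. [folklore] -/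
theorem ddRperpW_eq (W : Tor (fine N M) → ℂ) (a m2 : ℝ) (μ ν : Fin d) (x x' : Tor (fine N M)) :
    ddRperpW N M W a m2 μ ν x x' = ((Fintype.card (Tor (fine N M)) : ℂ))⁻¹ *
      ∑ q ∈ (Finset.univ : Finset (Tor M)).erase 0,
        (kapW N M W a ((N : ℝ) ^ 2) m2 q : ℂ) * dfampW N M W m2 q μ x * conj (dfampW N M W m2 q ν x') := by
  unfold ddRperpW RperpW dfampW
  simp only [map_sub]
  rw [← mul_sub, ← mul_sub, ← mul_add, ← Finset.sum_sub_distrib, ← Finset.sum_sub_distrib,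
    ← Finset.sum_add_distrib]
  congr 1
  exact Finset.sum_congr rfl fun q _ => by ring

end Diff

section Four2

variable (N M₀ : ℕ) [NeZero N] [NeZero M₀]

/-- the constant `D₁ᶜ(m²) = 5/2 + E₁ᶜ(4, m²)`. [folklore] -/
def woodburyD1c (m2 : ℝ) : ℝ := 5 / 2 + mixedEc 4 m2

/-- the constant `D₂ᶜ(m²) = E₂ᶜ(4, m²)`. [folklore] -/
def woodburyD2c (m2 : ℝ) : ℝ := doubleEc 4 m2

/-- **MAIN BOUND, ONE DIFFERENCE (d = 4)** for an admissible weight: `‖∇_μ^x R^⊥_w(x,x′)‖ ≤ D₁ᶜ(m²)/N⁵` for all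
`x, x′, μ`, uniformly in the volume `M₀` and in `a > 0`. [folklore] -/
theorem norm_dRperpW_le {W : Tor (fine N (cM M₀)) → ℂ} (hW : Admissible N (cM M₀) W) (hN : 1 ≤ N) {a m2 : ℝ}
    (ha : 0 < a) (hm2 : 0 ≤ m2) (μ : Fin 4) (x x' : Tor (fine N (cM M₀))) :
    ‖dRperpW N (cM M₀) W a m2 μ x x'‖ ≤ woodburyD1c m2 / (N : ℝ) ^ 5 := by
  have hM : (0 : ℝ) < M₀ := by exact_mod_cast Nat.pos_of_ne_zero (NeZero.ne M₀)
  have hNr : (0 : ℝ) < N := by exact_mod_cast (show 0 < N by omega)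
  have hcard := card_tor_fine N M₀
  have hcardC : ((Fintype.card (Tor (fine N (cM M₀))) : ℂ)) = (((N : ℝ) ^ 4 * (M₀ : ℝ) ^ 4 : ℝ) : ℂ) := by
    rw [← hcard]; push_cast; rfl
  have hE0 : 0 ≤ mixedEc 4 m2 := mixedEc_nonneg 4 hm2
  have hsum : ∑ q ∈ (Finset.univ : Finset (Tor (cM M₀))).erase 0,
      ‖(kapW N (cM M₀) W a ((N : ℝ) ^ 2) m2 q : ℂ) * dfampW N (cM M₀) W m2 q μ x * conj (fampW N (cM M₀) W m2 q x')‖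
        ≤ ((5 / 2) * (M₀ : ℝ) ^ 4 + (M₀ : ℝ) ^ 4 * mixedEc 4 m2) / N := by
    calc ∑ q ∈ (Finset.univ : Finset (Tor (cM M₀))).erase 0,
          ‖(kapW N (cM M₀) W a ((N : ℝ) ^ 2) m2 q : ℂ) * dfampW N (cM M₀) W m2 q μ x
            * conj (fampW N (cM M₀) W m2 q x')‖
        ≤ ∑ q ∈ (Finset.univ : Finset (Tor (cM M₀))).erase 0,
            (1 / Real.sqrt (lapSym (fine N (cM M₀)) ((N : ℝ) ^ 2) m2 (z N (cM M₀) q)) + mixedEc 4 m2) / N :=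
          Finset.sum_le_sum fun q hq =>
            mixed_termW_le N (cM M₀) hW (by norm_num) hN ha hm2 (Finset.ne_of_mem_erase hq) μ x x'
      _ = (∑ q ∈ (Finset.univ : Finset (Tor (cM M₀))).erase 0,
            1 / Real.sqrt (lapSym (fine N (cM M₀)) ((N : ℝ) ^ 2) m2 (z N (cM M₀) q))
          + (((Finset.univ : Finset (Tor (cM M₀))).erase 0).card : ℝ) * mixedEc 4 m2) / N := by
          rw [← Finset.sum_div, Finset.sum_add_distrib, Finset.sum_const, nsmul_eq_mul]
      _ ≤ ((5 / 2) * (M₀ : ℝ) ^ 4 + (M₀ : ℝ) ^ 4 * mixedEc 4 m2) / N := by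
          gcongr
          · exact sum_inv_sqrt_lapSym_z_le N M₀ hN hm2
          · exact card_erase_zero_le M₀
  rw [dRperpW_eq, norm_mul, norm_inv, hcardC, Complex.norm_real, Real.norm_eq_abs, abs_of_pos (by positivity)]
  calc ((N : ℝ) ^ 4 * (M₀ : ℝ) ^ 4)⁻¹ *
        ‖∑ q ∈ (Finset.univ : Finset (Tor (cM M₀))).erase 0,
          (kapW N (cM M₀) W a ((N : ℝ) ^ 2) m2 q : ℂ) * dfampW N (cM M₀) W m2 q μ x
            * conj (fampW N (cM M₀) W m2 q x')‖
      ≤ ((N : ℝ) ^ 4 * (M₀ : ℝ) ^ 4)⁻¹ * (((5 / 2) * (M₀ : ℝ) ^ 4 + (M₀ : ℝ) ^ 4 * mixedEc 4 m2) / N) := by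
        refine mul_le_mul_of_nonneg_left ((norm_sum_le _ _).trans hsum) (by positivity)
    _ = woodburyD1c m2 / (N : ℝ) ^ 5 := by
        rw [woodburyD1c]
        field_simp

/-- **MAIN BOUND, TWO DIFFERENCES (d = 4)** for an admissible weight: `‖∇_μ^x∇_ν^{x′} R^⊥_w(x,x′)‖ ≤ D₂ᶜ(m²)/N⁶`
for all `x, x′, μ, ν`, uniformly in the volume `M₀` and in `a > 0`. [folklore] -/
theorem norm_ddRperpW_le {W : Tor (fine N (cM M₀)) → ℂ} (hW : Admissible N (cM M₀) W) (hN : 1 ≤ N) {a m2 : ℝ}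
    (ha : 0 < a) (hm2 : 0 ≤ m2) (μ ν : Fin 4) (x x' : Tor (fine N (cM M₀))) :
    ‖ddRperpW N (cM M₀) W a m2 μ ν x x'‖ ≤ woodburyD2c m2 / (N : ℝ) ^ 6 := by
  have hM : (0 : ℝ) < M₀ := by exact_mod_cast Nat.pos_of_ne_zero (NeZero.ne M₀)
  have hNr : (0 : ℝ) < N := by exact_mod_cast (show 0 < N by omega)
  have hcard := card_tor_fine N M₀
  have hcardC : ((Fintype.card (Tor (fine N (cM M₀))) : ℂ)) = (((N : ℝ) ^ 4 * (M₀ : ℝ) ^ 4 : ℝ) : ℂ) := by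
    rw [← hcard]; push_cast; rfl
  have hE0 : 0 ≤ doubleEc 4 m2 := doubleEc_nonneg 4 hm2
  have hsum : ∑ q ∈ (Finset.univ : Finset (Tor (cM M₀))).erase 0,
      ‖(kapW N (cM M₀) W a ((N : ℝ) ^ 2) m2 q : ℂ) * dfampW N (cM M₀) W m2 q μ x
        * conj (dfampW N (cM M₀) W m2 q ν x')‖
        ≤ (M₀ : ℝ) ^ 4 * (doubleEc 4 m2 / (N : ℝ) ^ 2) := by
    calc ∑ q ∈ (Finset.univ : Finset (Tor (cM M₀))).erase 0,
          ‖(kapW N (cM M₀) W a ((N : ℝ) ^ 2) m2 q : ℂ) * dfampW N (cM M₀) W m2 q μ x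
            * conj (dfampW N (cM M₀) W m2 q ν x')‖
        ≤ ∑ q ∈ (Finset.univ : Finset (Tor (cM M₀))).erase 0, doubleEc 4 m2 / (N : ℝ) ^ 2 :=
          Finset.sum_le_sum fun q hq =>
            double_termW_le N (cM M₀) hW (by norm_num) hN ha hm2 (Finset.ne_of_mem_erase hq) μ ν x x'
      _ = (((Finset.univ : Finset (Tor (cM M₀))).erase 0).card : ℝ) * (doubleEc 4 m2 / (N : ℝ) ^ 2) := by
          rw [Finset.sum_const, nsmul_eq_mul]
      _ ≤ (M₀ : ℝ) ^ 4 * (doubleEc 4 m2 / (N : ℝ) ^ 2) :=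
          mul_le_mul_of_nonneg_right (card_erase_zero_le M₀) (by positivity)
  rw [ddRperpW_eq, norm_mul, norm_inv, hcardC, Complex.norm_real, Real.norm_eq_abs, abs_of_pos (by positivity)]
  calc ((N : ℝ) ^ 4 * (M₀ : ℝ) ^ 4)⁻¹ *
        ‖∑ q ∈ (Finset.univ : Finset (Tor (cM M₀))).erase 0,
          (kapW N (cM M₀) W a ((N : ℝ) ^ 2) m2 q : ℂ) * dfampW N (cM M₀) W m2 q μ x
            * conj (dfampW N (cM M₀) W m2 q ν x')‖
      ≤ ((N : ℝ) ^ 4 * (M₀ : ℝ) ^ 4)⁻¹ * ((M₀ : ℝ) ^ 4 * (doubleEc 4 m2 / (N : ℝ) ^ 2)) := by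
        refine mul_le_mul_of_nonneg_left ((norm_sum_le _ _).trans hsum) (by positivity)
    _ = woodburyD2c m2 / (N : ℝ) ^ 6 := by
        rw [woodburyD2c]
        field_simp

end Four2

/-! ## §7 The massless endpoint `m2 = 0` (`a > 0`): the decomposition persists, by continuity

`hat_covOp_inv` is stated for `m2 > 0`.  For `a > 0` every term of the decomposition is continuous at `m2 = 0`
(all denominators `σ(p)`, `p ≠ 0`, and `1 + aS_w(q)`, `m2 + a` stay positive), so the identity at `m2 = 0` follows by
uniqueness of limits along `m2 → 0⁺` of the MATRIX identity `Gdec_w(m2) · A_B(m2) = 1` — which at the same time PROVES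
the invertibility of `A_B` at `m2 = 0` (exactly as in `WoodburyFibre` §7). -/

section Endpoint

open Filter Topology

variable (N : ℕ) [NeZero N] (M : Fin d → ℕ) [hM : ∀ μ, NeZero (M μ)]

/-- `m2 ↦ A^w_q(x)` is continuous at `0` for `q ≠ 0`. [folklore] -/
theorem continuousAt_fampW (W : Tor (fine N M) → ℂ) (hN : 1 ≤ N) {q : Tor M} (hq : q ≠ 0) (x : Tor (fine N M)) :
    ContinuousAt (fun m2 : ℝ => fampW N M W m2 q x) 0 := by
  have h : (fun m2 : ℝ => fampW N M W m2 q x) = fun m2 => ∑ m : Fin d → Fin N,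
      conj (chi (fine N M) (pOf N M (m, q)) x)
        * (W (pOf N M (m, q)) / (lapSym (fine N M) ((N : ℝ) ^ 2) m2 (pOf N M (m, q)) : ℂ)) := by
    funext m2; unfold fampW; rw [sum_fib_eq_sum_pOf]
  rw [h]
  exact continuousAt_finsetSum _ fun m _ =>
    ContinuousAt.mul continuousAt_const (continuousAt_div_lapSym N M hN (pOf_ne_zero N M hq m) _)

/-- `m2 ↦ S_w(q)` is continuous at `0` for `q ≠ 0`. [folklore] -/
theorem continuousAt_SfibW (W : Tor (fine N M) → ℂ) (hN : 1 ≤ N) {q : Tor M} (hq : q ≠ 0) :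
    ContinuousAt (fun m2 : ℝ => SfibW N M W ((N : ℝ) ^ 2) m2 q) 0 := by
  have hNr : (0 : ℝ) < N := by exact_mod_cast (show 0 < N by omega)
  have h : (fun m2 : ℝ => SfibW N M W ((N : ℝ) ^ 2) m2 q) = fun m2 => ∑ m : Fin d → Fin N,
      ‖W (pOf N M (m, q))‖ ^ 2 / lapSym (fine N M) ((N : ℝ) ^ 2) m2 (pOf N M (m, q)) := by
    funext m2; unfold SfibW; rw [sum_fib_eq_sum_pOf]
  rw [h]
  refine continuousAt_finsetSum _ fun m _ => ?_
  refine ContinuousAt.div₀ continuousAt_const (continuous_lapSym (fine N M) _ _).continuousAt ?_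
  exact (lapSym_pos_of_ne_zero (fine N M) (c := (N : ℝ) ^ 2) (m2 := 0) (by positivity) le_rfl
    (pOf_ne_zero N M hq m)).ne'

/-- `m2 ↦ κ_w(q)` is continuous at `0` for `q ≠ 0`, `a ≥ 0`. [folklore] -/
theorem continuousAt_kapW (W : Tor (fine N M) → ℂ) (hN : 1 ≤ N) {a : ℝ} (ha : 0 ≤ a) {q : Tor M} (hq : q ≠ 0) :
    ContinuousAt (fun m2 : ℝ => (kapW N M W a ((N : ℝ) ^ 2) m2 q : ℂ)) 0 := by
  have hNr : (0 : ℝ) < N := by exact_mod_cast (show 0 < N by omega)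
  have hreal : ContinuousAt (fun m2 : ℝ => kapW N M W a ((N : ℝ) ^ 2) m2 q) 0 := by
    unfold kapW
    refine ContinuousAt.div₀ continuousAt_const
      (ContinuousAt.add continuousAt_const (ContinuousAt.mul continuousAt_const (continuousAt_SfibW N M W hN hq))) ?_
    have := SfibW_nonneg N M W (c := (N : ℝ) ^ 2) (m2 := 0) (by positivity) le_rfl q
    show 1 + a * SfibW N M W ((N : ℝ) ^ 2) 0 q ≠ 0
    positivity
  exact Complex.continuous_ofReal.continuousAt.comp hreal

/-- `m2 ↦ R^⊥_w(x,x′)` is continuous at `0` for `a ≥ 0`. [folklore] -/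
theorem continuousAt_RperpW (W : Tor (fine N M) → ℂ) (hN : 1 ≤ N) {a : ℝ} (ha : 0 ≤ a) (x x' : Tor (fine N M)) :
    ContinuousAt (fun m2 : ℝ => RperpW N M W a m2 x x') 0 := by
  unfold RperpW
  refine ContinuousAt.mul continuousAt_const (continuousAt_finsetSum _ fun q hq => ?_)
  have hq0 : q ≠ 0 := Finset.ne_of_mem_erase hq
  exact ContinuousAt.mul (ContinuousAt.mul (continuousAt_kapW N M W hN ha hq0) (continuousAt_fampW N M W hN hq0 x))
    (Complex.continuous_conj.continuousAt.comp (continuousAt_fampW N M W hN hq0 x'))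

/-- THE RIGHT-HAND SIDE OF THE DECOMPOSITION AS A COMPLEX MATRIX, for any `m2`. [folklore] -/
def GdecW (W : Tor (fine N M) → ℂ) (a m2 : ℝ) : Matrix (Tor (fine N M)) (Tor (fine N M)) ℂ := fun x x' =>
  GfreePerp N M m2 (x' - x) + ((Fintype.card (Tor (fine N M)) : ℂ))⁻¹ * (1 / ((m2 : ℂ) + a))
    - RperpW N M W a m2 x x'

/-- entrywise continuity of `Gdec_w` at `m2 = 0` (`a > 0`). [folklore] -/
theorem continuousAt_GdecW (W : Tor (fine N M) → ℂ) (hN : 1 ≤ N) {a : ℝ} (ha : 0 < a) (x x' : Tor (fine N M)) :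
    ContinuousAt (fun m2 : ℝ => GdecW N M W a m2 x x') 0 := by
  unfold GdecW
  refine ContinuousAt.sub (ContinuousAt.add ?_ ?_) (continuousAt_RperpW N M W hN ha.le x x')
  · exact (continuousAt_GfreePerp N M hN (x' - x))
  · refine ContinuousAt.mul continuousAt_const (ContinuousAt.div₀ continuousAt_const
      (ContinuousAt.add Complex.continuous_ofReal.continuousAt continuousAt_const) ?_)
    rw [Complex.ofReal_zero, zero_add]
    exact_mod_cast ha.ne'

/-- for `m2 > 0`, `Gdec_{w_B}` IS the (complexified) inverse of `A_B`: the decomposition entrywise. [folklore] -/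
theorem GdecW_eq_map_inv {B : Matrix (Tor M) (Tor (fine N M)) ℝ} (hB : Covariant N M B)
    (hW : Admissible N M (wt N M B)) (hN : 1 ≤ N) {a m2 : ℝ} (ha : 0 ≤ a) (hm : 0 < m2) :
    GdecW N M (wt N M B) a m2 = ((covOp N M B a ((N : ℝ) ^ 2) m2)⁻¹).map Complex.ofRealHom := by
  ext x x'
  rw [Matrix.map_apply, Complex.ofRealHom_eq_coe, covOp_inv_decomposition N M hB hW hN ha hm x x']
  rfl

/-- for `m2 > 0`: `Gdec_{w_B}(m2) · A_B(m2) = 1`. [folklore] -/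
theorem GdecW_mul_covOp {B : Matrix (Tor M) (Tor (fine N M)) ℝ} (hB : Covariant N M B)
    (hW : Admissible N M (wt N M B)) (hN : 1 ≤ N) {a m2 : ℝ} (ha : 0 ≤ a) (hm : 0 < m2) :
    GdecW N M (wt N M B) a m2 * (covOp N M B a ((N : ℝ) ^ 2) m2).map Complex.ofRealHom = 1 := by
  have hNr : (0 : ℝ) < N := by exact_mod_cast (show 0 < N by omega)
  have hu : IsUnit (covOp N M B a ((N : ℝ) ^ 2) m2).det :=
    (Matrix.isUnit_iff_isUnit_det _).mp (covOp_isUnit N M B ha (by positivity) hm)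
  rw [GdecW_eq_map_inv N M hB hW hN ha hm, ← Matrix.map_mul, Matrix.nonsing_inv_mul _ hu,
    Matrix.map_one _ (map_zero _) (map_one _)]

omit [NeZero N] in
/-- the entries of `m2 ↦ A_B(m2)` are continuous (affine). [folklore] -/
theorem continuous_covOp_entry (B : Matrix (Tor M) (Tor (fine N M)) ℝ) (a c : ℝ) (x y : Tor (fine N M)) :
    Continuous fun m2 : ℝ => ((covOp N M B a c m2 x y : ℝ) : ℂ) := by
  refine Complex.continuous_ofReal.comp ?_
  unfold covOp lapF
  simp only [Matrix.add_apply, Matrix.smul_apply, smul_eq_mul]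
  fun_prop

/-- **`Gdec_{w_B}(0) · A_B(0) = 1`** for `a > 0`: the limit `m2 → 0⁺` of `Gdec_{w_B}(m2) · A_B(m2) = 1`. [folklore] -/
theorem GdecW_mul_covOp_zero {B : Matrix (Tor M) (Tor (fine N M)) ℝ} (hB : Covariant N M B)
    (hW : Admissible N M (wt N M B)) (hN : 1 ≤ N) {a : ℝ} (ha : 0 < a) :
    GdecW N M (wt N M B) a 0 * (covOp N M B a ((N : ℝ) ^ 2) 0).map Complex.ofRealHom = 1 := by
  ext x y
  set g : ℝ → ℂ := fun m2 =>
    (GdecW N M (wt N M B) a m2 * (covOp N M B a ((N : ℝ) ^ 2) m2).map Complex.ofRealHom) x y with hg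
  have hcont : ContinuousAt g 0 := by
    have e : g = fun m2 => ∑ x', GdecW N M (wt N M B) a m2 x x'
        * ((covOp N M B a ((N : ℝ) ^ 2) m2 x' y : ℝ) : ℂ) := by
      funext m2; simp only [hg, Matrix.mul_apply, Matrix.map_apply, Complex.ofRealHom_eq_coe]
    rw [e]
    exact continuousAt_finsetSum _ fun x' _ =>
      ContinuousAt.mul (continuousAt_GdecW N M _ hN ha x x') (continuous_covOp_entry N M B a _ x' y).continuousAt
  have h1 : Tendsto g (𝓝[>] 0) (𝓝 (g 0)) := hcont.tendsto.mono_left nhdsWithin_le_nhds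
  have h2 : Tendsto g (𝓝[>] 0) (𝓝 ((1 : Matrix (Tor (fine N M)) (Tor (fine N M)) ℂ) x y)) := by
    apply tendsto_const_nhds.congr'
    filter_upwards [self_mem_nhdsWithin] with m2 hm2
    show (1 : Matrix (Tor (fine N M)) (Tor (fine N M)) ℂ) x y = g m2
    rw [hg]
    simp only
    rw [GdecW_mul_covOp N M hB hW hN ha.le (Set.mem_Ioi.mp hm2)]
  have := tendsto_nhds_unique h1 h2
  simpa only [hg] using this

/-- **`A_B = N²(−Δ) + aN^d BᵀB` is invertible at `m2 = 0` for `a > 0`** (massless torus; the covariant averaging term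
lifts the zero mode because `w_B(0) = 1`). [folklore] -/
theorem isUnit_covOp_zero {B : Matrix (Tor M) (Tor (fine N M)) ℝ} (hB : Covariant N M B)
    (hW : Admissible N M (wt N M B)) (hN : 1 ≤ N) {a : ℝ} (ha : 0 < a) :
    IsUnit (covOp N M B a ((N : ℝ) ^ 2) 0) := by
  have h := Matrix.isUnit_det_of_left_inverse (GdecW_mul_covOp_zero N M hB hW hN ha)
  rw [← RingHom.mapMatrix_apply, ← RingHom.map_det] at h
  rw [Matrix.isUnit_iff_isUnit_det, isUnit_iff_ne_zero]
  intro h0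
  rw [h0, map_zero] at h
  exact not_isUnit_zero h

/-- **(P0₀) THE EXACT DECOMPOSITION AT THE MASSLESS ENDPOINT** (`a > 0`, `N ≥ 1`, any `d`, any periods):
`A_B⁻¹(x,x′)|_{m2=0} = G_free,0^⊥(x′ − x) + |𝕋|⁻¹a⁻¹ − R^⊥_{w_B,0}(x,x′)`. [folklore] -/
theorem covOp_inv_zero_decomposition {B : Matrix (Tor M) (Tor (fine N M)) ℝ} (hB : Covariant N M B)
    (hW : Admissible N M (wt N M B)) (hN : 1 ≤ N) {a : ℝ} (ha : 0 < a) (x x' : Tor (fine N M)) :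
    ((((covOp N M B a ((N : ℝ) ^ 2) 0)⁻¹ x x' : ℝ)) : ℂ)
      = GfreePerp N M 0 (x' - x) + ((Fintype.card (Tor (fine N M)) : ℂ))⁻¹ * (1 / (a : ℂ))
        - RperpW N M (wt N M B) a 0 x x' := by
  have hunit := isUnit_covOp_zero N M hB hW hN ha
  have hmap : ((covOp N M B a ((N : ℝ) ^ 2) 0)⁻¹).map Complex.ofRealHom
      * (covOp N M B a ((N : ℝ) ^ 2) 0).map Complex.ofRealHom = 1 := by
    rw [← Matrix.map_mul, Matrix.nonsing_inv_mul _ ((Matrix.isUnit_iff_isUnit_det _).mp hunit),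
      Matrix.map_one _ (map_zero _) (map_one _)]
  have h1 := Matrix.inv_eq_left_inv hmap
  have h2 := Matrix.inv_eq_left_inv (GdecW_mul_covOp_zero N M hB hW hN ha)
  have h3 := congrFun (congrFun (h1.symm.trans h2) x) x'
  rw [Matrix.map_apply, Complex.ofRealHom_eq_coe] at h3
  rw [h3]
  simp only [GdecW, Complex.ofReal_zero, zero_add]

end Endpoint

/-! ## §8 LATTICE UNITS: `Γ_B := (−Δ₁ + m² + aN^dBᵀB)⁻¹ = C^⊥ + |𝕋|⁻¹(m²+a)⁻¹ − R^lat_w`,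
`|R^lat_w| ≤ D₀ᶜL⁻²`, `|∇R^lat_w| ≤ D₁ᶜL⁻³`, `|∇R^lat_w∇′| ≤ D₂ᶜL⁻⁴` with `L = N` -/

section Lattice

variable (N : ℕ) [NeZero N] (M : Fin d → ℕ) [hM : ∀ μ, NeZero (M μ)]

/-- THE LATTICE-UNIT WOODBURY CORRECTION `R^lat_w = N² · R^⊥_w(a_K = N²a, m²_K = N²m²)`. [folklore] -/
def RlatW (W : Tor (fine N M) → ℂ) (a m2 : ℝ) (x x' : Tor (fine N M)) : ℂ :=
  ((N : ℂ)) ^ 2 * RperpW N M W ((N : ℝ) ^ 2 * a) ((N : ℝ) ^ 2 * m2) x x'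

/-- **(P0_lat) THE DECOMPOSITION IN LATTICE UNITS** for a coarse-covariant averaging `B` with admissible weight
(`a > 0`, `m2 ≥ 0` INCLUDING THE MASSLESS CASE, `N ≥ 1`, any `d`, any periods):
`Γ_B(x,x′) := (−Δ₁ + m² + aN^dBᵀB)⁻¹(x,x′) = C^⊥(x′ − x) + |𝕋|⁻¹(m² + a)⁻¹ − R^lat_{w_B}(x,x′)`. [folklore] -/
theorem latticeCovInv_decomposition {B : Matrix (Tor M) (Tor (fine N M)) ℝ} (hB : Covariant N M B)
    (hW : Admissible N M (wt N M B)) (hN : 1 ≤ N) {a m2 : ℝ} (ha : 0 < a) (hm2 : 0 ≤ m2)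
    (x x' : Tor (fine N M)) :
    ((((covOp N M B a 1 m2)⁻¹ x x' : ℝ)) : ℂ)
      = GfreeLat N M m2 (x' - x) + ((Fintype.card (Tor (fine N M)) : ℂ))⁻¹ * (1 / ((m2 : ℂ) + a))
        - RlatW N M (wt N M B) a m2 x x' := by
  have hNr : (0 : ℝ) < N := by exact_mod_cast (show 0 < N by omega)
  have hN2 : ((N : ℝ)) ^ 2 ≠ 0 := by positivity
  have hN2C : ((N : ℂ)) ^ 2 ≠ 0 := pow_ne_zero 2 (Nat.cast_ne_zero.mpr (NeZero.ne N))
  have hscale : covOp N M B a 1 m2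
      = (((N : ℝ)) ^ 2)⁻¹ • covOp N M B ((N : ℝ) ^ 2 * a) ((N : ℝ) ^ 2) ((N : ℝ) ^ 2 * m2) := by
    rw [covOp_scale, smul_smul, inv_mul_cancel₀ hN2, one_smul]
  have hunit : IsUnit (covOp N M B ((N : ℝ) ^ 2 * a) ((N : ℝ) ^ 2) ((N : ℝ) ^ 2 * m2)) := by
    rcases hm2.eq_or_lt with h0 | hpos
    · rw [← h0, mul_zero]; exact isUnit_covOp_zero N M hB hW hN (by positivity)
    · exact covOp_isUnit N M B (by positivity) (by positivity) (by positivity)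
  have hinv : (covOp N M B a 1 m2)⁻¹
      = ((N : ℝ)) ^ 2 • (covOp N M B ((N : ℝ) ^ 2 * a) ((N : ℝ) ^ 2) ((N : ℝ) ^ 2 * m2))⁻¹ := by
    rw [hscale, inv_smul_of_isUnit hunit (inv_ne_zero hN2), inv_inv]
  have hE : ((((covOp N M B ((N : ℝ) ^ 2 * a) ((N : ℝ) ^ 2) ((N : ℝ) ^ 2 * m2))⁻¹ x x' : ℝ)) : ℂ)
      = GfreePerp N M ((N : ℝ) ^ 2 * m2) (x' - x)
        + ((Fintype.card (Tor (fine N M)) : ℂ))⁻¹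
            * (1 / (((((N : ℝ) ^ 2 * m2 : ℝ)) : ℂ) + ((((N : ℝ) ^ 2 * a : ℝ)) : ℂ)))
        - RperpW N M (wt N M B) ((N : ℝ) ^ 2 * a) ((N : ℝ) ^ 2 * m2) x x' := by
    rcases hm2.eq_or_lt with h0 | hpos
    · have h := covOp_inv_zero_decomposition N M hB hW hN (a := (N : ℝ) ^ 2 * a) (by positivity) x x'
      rw [← h0]
      simp only [mul_zero]
      rw [h]
      simp
    · exact covOp_inv_decomposition N M hB hW hN (by positivity) (by positivity) x x'
  have hma : ((m2 : ℂ) + a) ≠ 0 := by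
    have : (0 : ℝ) < m2 + a := by linarith
    exact_mod_cast this.ne'
  have hNC : (N : ℂ) ≠ 0 := Nat.cast_ne_zero.mpr (NeZero.ne N)
  rw [hinv, Matrix.smul_apply, smul_eq_mul, Complex.ofReal_mul, hE]
  unfold RlatW
  rw [← GfreePerp_scale]
  push_cast
  field_simp

/-- the lattice-unit differenced corrections `∇_μ^x R^lat_w`, `∇_μ^x∇_ν^{x′} R^lat_w`. [folklore] -/
def dRlatW (W : Tor (fine N M) → ℂ) (a m2 : ℝ) (μ : Fin d) (x x' : Tor (fine N M)) : ℂ :=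
  RlatW N M W a m2 (x + unitVec (fine N M) μ) x' - RlatW N M W a m2 x x'

/-- see `dRlatW`. [folklore] -/
def ddRlatW (W : Tor (fine N M) → ℂ) (a m2 : ℝ) (μ ν : Fin d) (x x' : Tor (fine N M)) : ℂ :=
  RlatW N M W a m2 (x + unitVec (fine N M) μ) (x' + unitVec (fine N M) ν)
    - RlatW N M W a m2 (x + unitVec (fine N M) μ) x'
    - RlatW N M W a m2 x (x' + unitVec (fine N M) ν) + RlatW N M W a m2 x x'

/-- `∇R^lat_w = N² ∇R^⊥_w`. [folklore] -/
theorem dRlatW_eq (W : Tor (fine N M) → ℂ) (a m2 : ℝ) (μ : Fin d) (x x' : Tor (fine N M)) :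
    dRlatW N M W a m2 μ x x' = ((N : ℂ)) ^ 2 * dRperpW N M W ((N : ℝ) ^ 2 * a) ((N : ℝ) ^ 2 * m2) μ x x' := by
  unfold dRlatW RlatW dRperpW; ring

/-- `∇∇′R^lat_w = N² ∇∇′R^⊥_w`. [folklore] -/
theorem ddRlatW_eq (W : Tor (fine N M) → ℂ) (a m2 : ℝ) (μ ν : Fin d) (x x' : Tor (fine N M)) :
    ddRlatW N M W a m2 μ ν x x'
      = ((N : ℂ)) ^ 2 * ddRperpW N M W ((N : ℝ) ^ 2 * a) ((N : ℝ) ^ 2 * m2) μ ν x x' := by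
  unfold ddRlatW RlatW ddRperpW; ring

end Lattice

section LatticeFour

variable (N M₀ : ℕ) [NeZero N] [NeZero M₀]

/-- **FLAT: `|R^lat_w(x,x′)| ≤ D₀ᶜ(N²m²)·L⁻²`** with `L = N`, for ALL `x, x′`, every `a > 0`, every volume `M₀`, every
`m2 ≥ 0`, every admissible weight (`d = 4`, equal periods). [folklore] -/
theorem norm_RlatW_le {W : Tor (fine N (cM M₀)) → ℂ} (hW : Admissible N (cM M₀) W) (hN : 1 ≤ N) {a m2 : ℝ}
    (ha : 0 < a) (hm2 : 0 ≤ m2) (x x' : Tor (fine N (cM M₀))) :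
    ‖RlatW N (cM M₀) W a m2 x x'‖ ≤ woodburyDc ((N : ℝ) ^ 2 * m2) / (N : ℝ) ^ 2 := by
  have hNr : (0 : ℝ) < N := by exact_mod_cast (show 0 < N by omega)
  unfold RlatW
  rw [norm_mul, norm_pow, Complex.norm_natCast]
  have h := norm_RperpW_le N M₀ hW hN (a := (N : ℝ) ^ 2 * a) (m2 := (N : ℝ) ^ 2 * m2) (by positivity)
    (by positivity) x x'
  calc (N : ℝ) ^ 2 * ‖RperpW N (cM M₀) W ((N : ℝ) ^ 2 * a) ((N : ℝ) ^ 2 * m2) x x'‖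
      ≤ (N : ℝ) ^ 2 * (woodburyDc ((N : ℝ) ^ 2 * m2) / (N : ℝ) ^ 4) := by gcongr
    _ = woodburyDc ((N : ℝ) ^ 2 * m2) / (N : ℝ) ^ 2 := by field_simp

/-- **ONE DIFFERENCE: `|∇_μ R^lat_w(x,x′)| ≤ D₁ᶜ(N²m²)·L⁻³`**. [folklore] -/
theorem norm_dRlatW_le {W : Tor (fine N (cM M₀)) → ℂ} (hW : Admissible N (cM M₀) W) (hN : 1 ≤ N) {a m2 : ℝ}
    (ha : 0 < a) (hm2 : 0 ≤ m2) (μ : Fin 4) (x x' : Tor (fine N (cM M₀))) :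
    ‖dRlatW N (cM M₀) W a m2 μ x x'‖ ≤ woodburyD1c ((N : ℝ) ^ 2 * m2) / (N : ℝ) ^ 3 := by
  have hNr : (0 : ℝ) < N := by exact_mod_cast (show 0 < N by omega)
  rw [dRlatW_eq, norm_mul, norm_pow, Complex.norm_natCast]
  have h := norm_dRperpW_le N M₀ hW hN (a := (N : ℝ) ^ 2 * a) (m2 := (N : ℝ) ^ 2 * m2) (by positivity)
    (by positivity) μ x x'
  calc (N : ℝ) ^ 2 * ‖dRperpW N (cM M₀) W ((N : ℝ) ^ 2 * a) ((N : ℝ) ^ 2 * m2) μ x x'‖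
      ≤ (N : ℝ) ^ 2 * (woodburyD1c ((N : ℝ) ^ 2 * m2) / (N : ℝ) ^ 5) := by gcongr
    _ = woodburyD1c ((N : ℝ) ^ 2 * m2) / (N : ℝ) ^ 3 := by field_simp

/-- **TWO DIFFERENCES: `|∇_μ∇′_ν R^lat_w(x,x′)| ≤ D₂ᶜ(N²m²)·L⁻⁴`**. [folklore] -/
theorem norm_ddRlatW_le {W : Tor (fine N (cM M₀)) → ℂ} (hW : Admissible N (cM M₀) W) (hN : 1 ≤ N) {a m2 : ℝ}
    (ha : 0 < a) (hm2 : 0 ≤ m2) (μ ν : Fin 4) (x x' : Tor (fine N (cM M₀))) :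
    ‖ddRlatW N (cM M₀) W a m2 μ ν x x'‖ ≤ woodburyD2c ((N : ℝ) ^ 2 * m2) / (N : ℝ) ^ 4 := by
  have hNr : (0 : ℝ) < N := by exact_mod_cast (show 0 < N by omega)
  rw [ddRlatW_eq, norm_mul, norm_pow, Complex.norm_natCast]
  have h := norm_ddRperpW_le N M₀ hW hN (a := (N : ℝ) ^ 2 * a) (m2 := (N : ℝ) ^ 2 * m2) (by positivity)
    (by positivity) μ ν x x'
  calc (N : ℝ) ^ 2 * ‖ddRperpW N (cM M₀) W ((N : ℝ) ^ 2 * a) ((N : ℝ) ^ 2 * m2) μ ν x x'‖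
      ≤ (N : ℝ) ^ 2 * (woodburyD2c ((N : ℝ) ^ 2 * m2) / (N : ℝ) ^ 6) := by gcongr
    _ = woodburyD2c ((N : ℝ) ^ 2 * m2) / (N : ℝ) ^ 4 := by field_simp

/-- **THE MASSLESS CASE** (`m2 = 0`, every `a > 0`, every volume, every admissible weight): the three bounds with the
ABSOLUTE constants `woodburyDc 0`, `woodburyD1c 0`, `woodburyD2c 0`. [folklore] -/
theorem norm_RlatW_zero_le {W : Tor (fine N (cM M₀)) → ℂ} (hW : Admissible N (cM M₀) W) (hN : 1 ≤ N) {a : ℝ}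
    (ha : 0 < a) (μ ν : Fin 4) (x x' : Tor (fine N (cM M₀))) :
    ‖RlatW N (cM M₀) W a 0 x x'‖ ≤ woodburyDc 0 / (N : ℝ) ^ 2
      ∧ ‖dRlatW N (cM M₀) W a 0 μ x x'‖ ≤ woodburyD1c 0 / (N : ℝ) ^ 3
      ∧ ‖ddRlatW N (cM M₀) W a 0 μ ν x x'‖ ≤ woodburyD2c 0 / (N : ℝ) ^ 4 := by
  refine ⟨?_, ?_, ?_⟩
  · simpa using norm_RlatW_le N M₀ hW hN ha le_rfl x x'
  · simpa using norm_dRlatW_le N M₀ hW hN ha le_rfl μ x x'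
  · simpa using norm_ddRlatW_le N M₀ hW hN ha le_rfl μ ν x x'

end LatticeFour

/-! ## §9 Symmetry: `κ_w(q)` and `|𝕋|` are real, so `R^⊥_w(x′,x) = conj R^⊥_w(x,x′)`; second-leg differences -/

section Symmetry

variable (N : ℕ) [NeZero N] (M : Fin d → ℕ) [hM : ∀ μ, NeZero (M μ)]

/-- HERMITIAN SYMMETRY: `R^⊥_w(x′,x) = conj R^⊥_w(x,x′)`. [folklore] -/
theorem RperpW_swap (W : Tor (fine N M) → ℂ) (a m2 : ℝ) (x x' : Tor (fine N M)) :
    RperpW N M W a m2 x' x = conj (RperpW N M W a m2 x x') := by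
  unfold RperpW
  simp only [map_mul, map_inv₀, map_natCast, map_sum, Complex.conj_conj, Complex.conj_ofReal]
  congr 1
  exact Finset.sum_congr rfl fun q _ => by ring

/-- `‖R^⊥_w(x′,x)‖ = ‖R^⊥_w(x,x′)‖`. [folklore] -/
theorem norm_RperpW_swap (W : Tor (fine N M) → ℂ) (a m2 : ℝ) (x x' : Tor (fine N M)) :
    ‖RperpW N M W a m2 x' x‖ = ‖RperpW N M W a m2 x x'‖ := by
  rw [RperpW_swap, Complex.norm_conj]

/-- `R^lat_w(x′,x) = conj R^lat_w(x,x′)`. [folklore] -/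
theorem RlatW_swap (W : Tor (fine N M) → ℂ) (a m2 : ℝ) (x x' : Tor (fine N M)) :
    RlatW N M W a m2 x' x = conj (RlatW N M W a m2 x x') := by
  unfold RlatW
  rw [map_mul, map_pow, map_natCast, RperpW_swap]

/-- THE `x′`-DIFFERENCED KERNEL `∇′_ν R^⊥_w(x,x′) = R^⊥_w(x, x′+e_ν) − R^⊥_w(x,x′)`. [folklore] -/
def dRperpW' (W : Tor (fine N M) → ℂ) (a m2 : ℝ) (ν : Fin d) (x x' : Tor (fine N M)) : ℂ :=
  RperpW N M W a m2 x (x' + unitVec (fine N M) ν) - RperpW N M W a m2 x x'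

/-- THE `x′`-DIFFERENCED LATTICE-UNIT CORRECTION `∇′_ν R^lat_w(x,x′)`. [folklore] -/
def dRlatW' (W : Tor (fine N M) → ℂ) (a m2 : ℝ) (ν : Fin d) (x x' : Tor (fine N M)) : ℂ :=
  RlatW N M W a m2 x (x' + unitVec (fine N M) ν) - RlatW N M W a m2 x x'

/-- `∇′_ν R^⊥_w(x,x′) = conj ∇_ν R^⊥_w(x′,x)`. [folklore] -/
theorem dRperpW'_eq_conj (W : Tor (fine N M) → ℂ) (a m2 : ℝ) (ν : Fin d) (x x' : Tor (fine N M)) :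
    dRperpW' N M W a m2 ν x x' = conj (dRperpW N M W a m2 ν x' x) := by
  unfold dRperpW' dRperpW
  rw [map_sub, ← RperpW_swap, ← RperpW_swap]

/-- `∇′_ν R^lat_w(x,x′) = conj ∇_ν R^lat_w(x′,x)`. [folklore] -/
theorem dRlatW'_eq_conj (W : Tor (fine N M) → ℂ) (a m2 : ℝ) (ν : Fin d) (x x' : Tor (fine N M)) :
    dRlatW' N M W a m2 ν x x' = conj (dRlatW N M W a m2 ν x' x) := by
  unfold dRlatW' dRlatW
  rw [map_sub, ← RlatW_swap, ← RlatW_swap]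

/-- `‖∇′_ν R^⊥_w(x,x′)‖ = ‖∇_ν R^⊥_w(x′,x)‖`. [folklore] -/
theorem norm_dRperpW'_eq (W : Tor (fine N M) → ℂ) (a m2 : ℝ) (ν : Fin d) (x x' : Tor (fine N M)) :
    ‖dRperpW' N M W a m2 ν x x'‖ = ‖dRperpW N M W a m2 ν x' x‖ := by
  rw [dRperpW'_eq_conj, Complex.norm_conj]

/-- `‖∇′_ν R^lat_w(x,x′)‖ = ‖∇_ν R^lat_w(x′,x)‖`. [folklore] -/
theorem norm_dRlatW'_eq (W : Tor (fine N M) → ℂ) (a m2 : ℝ) (ν : Fin d) (x x' : Tor (fine N M)) :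
    ‖dRlatW' N M W a m2 ν x x'‖ = ‖dRlatW N M W a m2 ν x' x‖ := by
  rw [dRlatW'_eq_conj, Complex.norm_conj]

end Symmetry

section SymmetryFour

variable (N M₀ : ℕ) [NeZero N] [NeZero M₀]

/-- ONE DIFFERENCE ON THE SECOND LEG (d = 4): `‖∇′_ν R^⊥_w(x,x′)‖ ≤ D₁ᶜ(m²)/N⁵`. [folklore] -/
theorem norm_dRperpW'_le {W : Tor (fine N (cM M₀)) → ℂ} (hW : Admissible N (cM M₀) W) (hN : 1 ≤ N) {a m2 : ℝ}
    (ha : 0 < a) (hm2 : 0 ≤ m2) (ν : Fin 4) (x x' : Tor (fine N (cM M₀))) :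
    ‖dRperpW' N (cM M₀) W a m2 ν x x'‖ ≤ woodburyD1c m2 / (N : ℝ) ^ 5 := by
  rw [norm_dRperpW'_eq]
  exact norm_dRperpW_le N M₀ hW hN ha hm2 ν x' x

/-- **ONE DIFFERENCE ON THE SECOND LEG, LATTICE UNITS: `|∇′_ν R^lat_w(x,x′)| ≤ D₁ᶜ(N²m²)·L⁻³`**. [folklore] -/
theorem norm_dRlatW'_le {W : Tor (fine N (cM M₀)) → ℂ} (hW : Admissible N (cM M₀) W) (hN : 1 ≤ N) {a m2 : ℝ}
    (ha : 0 < a) (hm2 : 0 ≤ m2) (ν : Fin 4) (x x' : Tor (fine N (cM M₀))) :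
    ‖dRlatW' N (cM M₀) W a m2 ν x x'‖ ≤ woodburyD1c ((N : ℝ) ^ 2 * m2) / (N : ℝ) ^ 3 := by
  rw [norm_dRlatW'_eq]
  exact norm_dRlatW_le N M₀ hW hN ha hm2 ν x' x

/-- **THE MASSLESS CASE, BOTH LEGS** (`m2 = 0`, every `a > 0`, every volume, every admissible weight): `|R^lat_w| ≤ D₀ᶜ/L²`,
`|∇_μ R^lat_w| ≤ D₁ᶜ/L³`, `|∇′_ν R^lat_w| ≤ D₁ᶜ/L³`, `|∇_μ∇′_ν R^lat_w| ≤ D₂ᶜ/L⁴` with the ABSOLUTE constants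
`woodburyDc 0`, `woodburyD1c 0`, `woodburyD2c 0`. [folklore] -/
theorem norm_RlatW_zero_le' {W : Tor (fine N (cM M₀)) → ℂ} (hW : Admissible N (cM M₀) W) (hN : 1 ≤ N) {a : ℝ}
    (ha : 0 < a) (μ ν : Fin 4) (x x' : Tor (fine N (cM M₀))) :
    ‖RlatW N (cM M₀) W a 0 x x'‖ ≤ woodburyDc 0 / (N : ℝ) ^ 2
      ∧ ‖dRlatW N (cM M₀) W a 0 μ x x'‖ ≤ woodburyD1c 0 / (N : ℝ) ^ 3
      ∧ ‖dRlatW' N (cM M₀) W a 0 ν x x'‖ ≤ woodburyD1c 0 / (N : ℝ) ^ 3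
      ∧ ‖ddRlatW N (cM M₀) W a 0 μ ν x x'‖ ≤ woodburyD2c 0 / (N : ℝ) ^ 4 := by
  obtain ⟨h0, h1, h2⟩ := norm_RlatW_zero_le N M₀ hW hN ha μ ν x x'
  refine ⟨h0, h1, ?_, h2⟩
  simpa using norm_dRlatW'_le N M₀ hW hN ha le_rfl ν x x'

end SymmetryFour

/-! ## §10 THE BOND INSTANCE: Bałaban's bond-block average `(Q_k A)_{⟨y,y+e_μ⟩} = η^{d+1} Σ_{x ∈ B(y)} Σ_{t<N} A_μ(x + tηe_μ)`
((1.18) p.20 at `U = 1`, one component `μ`), its alias weight `w = u · v_μ` ((1.61) p.28), and its admissibility -/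

section Bond

variable (N : ℕ) [NeZero N] (M : Fin d → ℕ) [hM : ∀ μ, NeZero (M μ)]

/-- BAŁABAN'S BOND-BLOCK AVERAGE, `μ`-COMPONENT, TRIVIAL BACKGROUND (`U = 1`): the real `|𝕋_coarse| × |𝕋_fine|`
matrix whose row `y` puts weight `N^{-(d+1)}` (with multiplicity) on each fine site `N·y + j + t e_μ`,
`j ∈ {0,…,N−1}^d`, `t ∈ {0,…,N−1}` — the scalar transcription of [Balaban1984PropagatorsI, (1.18) p.20]
«(Q_kA)_b = Σ_{x∈B^k(b₋)} η^{d+1} A([x, x(b)])» for `b = ⟨y, y + e_μ⟩`, `A([x,x(b)]) = Σ_{t<N} A_μ(x + tηe_μ)`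
(DEFINITION/CONTEXT citation, as for the lineage's `B5Block118.QvOp`, with which `bondAvg_eq_QvOp` below identifies it).
[cite: Balaban1984PropagatorsI, (1.18) p.20] -/
def bondAvg (μ : Fin d) : Matrix (Tor M) (Tor (fine N M)) ℝ := fun y x =>
  ∑ j : Fin d → Fin N, ∑ t : Fin N,
    if x = B5Block118.bpt N M y j + B5Block118.tstep (fine N M) μ (t : ℕ) then (((N : ℝ) ^ (d + 1)))⁻¹ else 0

omit [NeZero N] hM in
/-- `bondAvg μ` IS the `(μ,μ)` block of the lineage's bond-averaging matrix `B5Block118.QvOp` ((1.18) p.20, typed in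
`B5Block118`): `(bondAvg μ) y x = QvOp (y,μ) (x,μ)` (and `QvOp (y,μ) (x,ν) = 0` for `ν ≠ μ` by definition). [folklore] -/
theorem bondAvg_eq_QvOp (μ : Fin d) (y : Tor M) (x : Tor (fine N M)) :
    ((bondAvg N M μ y x : ℝ) : ℂ) = B5Block118.QvOp N M (y, μ) (x, μ) := by
  simp only [bondAvg, B5Block118.QvOp, if_true, Complex.ofReal_sum, apply_ite Complex.ofReal,
    Complex.ofReal_inv, Complex.ofReal_pow, Complex.ofReal_natCast, Complex.ofReal_zero, one_div]

omit [NeZero N] in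
/-- `B^k(0) ∋ N·0 + j = j`. [folklore] -/
theorem bpt_zero (j : Fin d → Fin N) : B5Block118.bpt N M 0 j = B5Block118.iota N M j := by
  rw [B5Block118.bpt, ← corner_eq_up, corner_zero, zero_add]

omit [NeZero N] in
/-- the bond average is COARSE-COVARIANT (translation by a coarse vector `y` moves the block `B(0)` and its bonds to
`B(y)`: `N·y + j + te_μ − N·y = j + te_μ`). [folklore] -/
theorem covariant_bondAvg (μ : Fin d) : Covariant N M (bondAvg N M μ) := by
  intro y x
  unfold bondAvg
  refine Finset.sum_congr rfl fun j _ => Finset.sum_congr rfl fun t _ => ?_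
  rw [bpt_zero, B5Block118.bpt, ← corner_eq_up]
  have e : (x - corner N M y = B5Block118.iota N M j + B5Block118.tstep (fine N M) μ (t : ℕ))
      ↔ (x = corner N M y + B5Block118.iota N M j + B5Block118.tstep (fine N M) μ (t : ℕ)) := by
    rw [sub_eq_iff_eq_add]
    constructor
    · intro h; rw [h]; abel
    · intro h; rw [h]; abel
  exact if_congr e.symm rfl rfl

/-- row `0` of the bond average integrates a function over the bonds of the block at the origin:
`Σ_x (bondAvg μ) 0 x · f(x) = N^{-(d+1)} Σ_j Σ_{t<N} f(j + te_μ)`. [folklore] -/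
theorem sum_bondAvg_zero_mul (μ : Fin d) (f : Tor (fine N M) → ℂ) :
    ∑ x, ((bondAvg N M μ 0 x : ℝ) : ℂ) * f x
      = (((N : ℂ) ^ (d + 1)))⁻¹ * ∑ j : Fin d → Fin N, ∑ t : Fin N,
          f (B5Block118.iota N M j + B5Block118.tstep (fine N M) μ (t : ℕ)) := by
  simp only [bondAvg, bpt_zero, Complex.ofReal_sum, apply_ite Complex.ofReal, Complex.ofReal_inv,
    Complex.ofReal_pow, Complex.ofReal_natCast, Complex.ofReal_zero, Finset.sum_mul, ite_mul, zero_mul]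
  rw [Finset.sum_comm, Finset.mul_sum]
  refine Finset.sum_congr rfl fun j _ => ?_
  rw [Finset.sum_comm, Finset.mul_sum]
  refine Finset.sum_congr rfl fun t _ => ?_
  simp only [Finset.sum_ite_eq', Finset.mem_univ, if_true]

/-- King's block weight IS Bałaban's `u`: `u(p′ + l) = Π_ν v_ν(p′+l)` on the alias parametrisation. [folklore] -/
theorem u_pOf_eq_uSym (k : Fin d → Fin N) (q : Tor M) :
    u N M (pOf N M (k, q)) = B5Prop11Fiber.uSym N k (sOf M q) := by
  have hNc : (N : ℂ) ^ d ≠ 0 := pow_ne_zero d (by exact_mod_cast NeZero.ne N)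
  unfold u
  rw [B5Block118.sum_chi_iota, ← mul_assoc, inv_mul_cancel₀ hNc, one_mul]

/-- **THE ALIAS WEIGHT OF THE BOND AVERAGE IS `u · v_μ`**: `w_{bondAvg μ}(p′+l) = u(p′+l) · v_μ(p′+l)` with Bałaban's
`v_μ = ∂¹_μ(p′)/∂_μ(p)` of [Balaban1984PropagatorsI, (1.61) p.28] (typed as `B5Prop11Fiber.vSym`; the extra factor is
the average `(1/N)Σ_{t<N} e^{iηp_μ t}` over the `N` fine bonds of a coarse bond, `B5Block118.avg_om`). [folklore] -/
theorem wt_bondAvg_pOf (μ : Fin d) (k : Fin d → Fin N) (q : Tor M) :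
    wt N M (bondAvg N M μ) (pOf N M (k, q)) = u N M (pOf N M (k, q)) * B5Prop11Fiber.vSym N k (sOf M q) μ := by
  have hNc : (N : ℂ) ≠ 0 := by exact_mod_cast NeZero.ne N
  unfold wt
  rw [sum_bondAvg_zero_mul, u_pOf_eq_uSym]
  simp_rw [chi_add_right, B5Block118.chi_pOf_tstep, ← Finset.mul_sum, B5Block118.avg_om, ← Finset.sum_mul,
    B5Block118.sum_chi_iota]
  field_simp
  ring

/-- `|v_μ(p′)| ≥ 2/π` at the central alias (`l = 0`, `|p′_μ| ≤ π`; Jordan's inequality via `B4Strip.uFactorr_zero_ge`).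
[folklore] -/
theorem norm_vSym_central_ge (hN : 1 ≤ N) (q : Tor M) (μ : Fin d) :
    2 / π ≤ ‖B5Prop11Fiber.vSym N (fun _ => (0 : Fin N)) (sOf M q) μ‖ := by
  have h : (2 / π) ^ 2 ≤ ‖B5Prop11Fiber.vSym N (fun _ => (0 : Fin N)) (sOf M q) μ‖ ^ 2 := by
    rw [B5Prop11Fiber.norm_vSym_sq N hN _ _ μ (abs_sOf_le M q μ), Fin.val_zero]
    have := uFactorr_zero_ge N hN (sOf M q μ) (abs_sOf_le M q μ)
    convert this using 1
    ring
  exact (pow_le_pow_iff_left₀ (by positivity) (norm_nonneg _) two_ne_zero).mp h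

/-- **THE BOND WEIGHT IS ADMISSIBLE** (`N ≥ 1`): (W0) `w(0) = u(0)v_μ(0) = 1`; (W1) `|w| = |u||v_μ| ≤ |u|`
(`|v_μ| ≤ 1`, `B5Prop11Fiber.norm_vSym_le_one`); (W2) `|w(z_q)| ≥ (2/π)^d · (2/π)`. [folklore] -/
theorem admissible_bondAvg (hN : 1 ≤ N) (μ : Fin d) : Admissible N M (wt N M (bondAvg N M μ)) where
  zero := by
    rw [← z_zero N M, ← pOf_zero_eq_z, wt_bondAvg_pOf, pOf_zero_eq_z, z_zero, u_zero, one_mul,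
      B5Prop11Fiber.vSym, if_pos]
    exact (B5Prop11Fiber.dSym_eq_zero_iff N hN _ _ μ (abs_sOf_le M 0 μ)).mpr ⟨by simp, rfl⟩
  dom := fun p => by
    obtain ⟨⟨k, q⟩, rfl⟩ := (B5Block118.pOf_bijective N M).2 p
    rw [wt_bondAvg_pOf, norm_mul]
    exact mul_le_of_le_one_right (norm_nonneg _) (B5Prop11Fiber.norm_vSym_le_one N hN k (sOf M q) μ)
  cen := fun q => by
    rw [← pOf_zero_eq_z, wt_bondAvg_pOf, norm_mul, pOf_zero_eq_z, pow_succ]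
    exact mul_le_mul (norm_u_central_ge N M hN q) (norm_vSym_central_ge N M hN q μ) (by positivity)
      (norm_nonneg _)

omit [NeZero N] in
/-- THE BOND COVARIANCE OPERATOR in lattice units: `Γ_μ⁻¹ := −Δ₁ + m² + a·N^d (bondAvg μ)ᵀ(bondAvg μ)` — the scalar,
one-component, `U = 1` transcription of the quadratic form `a⟨Q_kA, Q_kA⟩` added to the free action (the `(μ,μ)`
block of `a·N^d·Q_kᵀQ_k` with `Q_k = B5Block118.QvOp`, by `bondAvg_eq_QvOp`). [folklore] -/
theorem covOp_bondAvg (μ : Fin d) (a m2 : ℝ) :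
    covOp N M (bondAvg N M μ) a 1 m2
      = lapF (fine N M) 1 m2 + a • (((N : ℝ) ^ d) • ((bondAvg N M μ)ᵀ * bondAvg N M μ)) := rfl

/-- **(P0_bond) THE EXACT DECOMPOSITION OF THE BOND COVARIANCE** (`a > 0`, `m2 ≥ 0` INCLUDING `m2 = 0`, `N ≥ 1`, any
`d`, any periods, every direction `μ`):
`Γ_μ(x,x′) = (−Δ₁ + m² + aN^d(bondAvg μ)ᵀ(bondAvg μ))⁻¹(x,x′) = C^⊥(x′ − x) + |𝕋|⁻¹(m²+a)⁻¹ − R^lat_{u·v_μ}(x,x′)`,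
with `C^⊥ = GfreeLat` the SAME volume-free, `a`-free mean-zero free lattice Green function as in the site certificate
`WoodburyFibre.latticeInv_decomposition`. [folklore] -/
theorem bondInv_decomposition (hN : 1 ≤ N) (μ : Fin d) {a m2 : ℝ} (ha : 0 < a) (hm2 : 0 ≤ m2)
    (x x' : Tor (fine N M)) :
    ((((covOp N M (bondAvg N M μ) a 1 m2)⁻¹ x x' : ℝ)) : ℂ)
      = GfreeLat N M m2 (x' - x) + ((Fintype.card (Tor (fine N M)) : ℂ))⁻¹ * (1 / ((m2 : ℂ) + a))
        - RlatW N M (wt N M (bondAvg N M μ)) a m2 x x' :=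
  latticeCovInv_decomposition N M (covariant_bondAvg N M μ) (admissible_bondAvg N M hN μ) hN ha hm2 x x'

/-- the King site certificate is the `B = Q` instance: same operator, same weight, same kernel. [folklore] -/
theorem RlatW_u_eq_RW (a m2 : ℝ) (x x' : Tor (fine N M)) : RlatW N M (u N M) a m2 x x' = RW N M a m2 x x' := by
  unfold RlatW RW RperpW Rperp kapW kap SfibW Sfib fampW famp
  rfl

end Bond

section BondFour

variable (N M₀ : ℕ) [NeZero N] [NeZero M₀]

/-- **THE BOND WOODBURY CERTIFICATE, `d = 4`, MASSLESS, BOTH LEGS** (every direction `μ₀`, every `a > 0`, every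
volume `M₀`, block side `L = N ≥ 1`): for the kernel `R^lat_{u·v_{μ₀}}` of `bondInv_decomposition` at `m2 = 0`,
`|R| ≤ D₀ᶜ/L²`, `|∇_μ R| ≤ D₁ᶜ/L³`, `|∇′_ν R| ≤ D₁ᶜ/L³`, `|∇_μ∇′_ν R| ≤ D₂ᶜ/L⁴` for ALL `x, x′`, with the ABSOLUTE
constants `woodburyDc 0`, `woodburyD1c 0`, `woodburyD2c 0` — the scale-form inputs of RULING (R7)(i) for the bond
covariance. [folklore] -/
theorem norm_Rbond_zero_le (hN : 1 ≤ N) {a : ℝ} (ha : 0 < a) (μ₀ μ ν : Fin 4) (x x' : Tor (fine N (cM M₀))) :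
    ‖RlatW N (cM M₀) (wt N (cM M₀) (bondAvg N (cM M₀) μ₀)) a 0 x x'‖ ≤ woodburyDc 0 / (N : ℝ) ^ 2
      ∧ ‖dRlatW N (cM M₀) (wt N (cM M₀) (bondAvg N (cM M₀) μ₀)) a 0 μ x x'‖ ≤ woodburyD1c 0 / (N : ℝ) ^ 3
      ∧ ‖dRlatW' N (cM M₀) (wt N (cM M₀) (bondAvg N (cM M₀) μ₀)) a 0 ν x x'‖ ≤ woodburyD1c 0 / (N : ℝ) ^ 3
      ∧ ‖ddRlatW N (cM M₀) (wt N (cM M₀) (bondAvg N (cM M₀) μ₀)) a 0 μ ν x x'‖ ≤ woodburyD2c 0 / (N : ℝ) ^ 4 :=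
  norm_RlatW_zero_le' N M₀ (admissible_bondAvg N (cM M₀) hN μ₀) hN ha μ ν x x'

/-- the massive version (`m2 ≥ 0`; constants evaluated at the King-scaled mass `N²m²`, monotone in it). [folklore] -/
theorem norm_Rbond_le (hN : 1 ≤ N) {a m2 : ℝ} (ha : 0 < a) (hm2 : 0 ≤ m2) (μ₀ μ ν : Fin 4)
    (x x' : Tor (fine N (cM M₀))) :
    ‖RlatW N (cM M₀) (wt N (cM M₀) (bondAvg N (cM M₀) μ₀)) a m2 x x'‖ ≤ woodburyDc ((N : ℝ) ^ 2 * m2) / (N : ℝ) ^ 2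
      ∧ ‖dRlatW N (cM M₀) (wt N (cM M₀) (bondAvg N (cM M₀) μ₀)) a m2 μ x x'‖
          ≤ woodburyD1c ((N : ℝ) ^ 2 * m2) / (N : ℝ) ^ 3
      ∧ ‖dRlatW' N (cM M₀) (wt N (cM M₀) (bondAvg N (cM M₀) μ₀)) a m2 ν x x'‖
          ≤ woodburyD1c ((N : ℝ) ^ 2 * m2) / (N : ℝ) ^ 3
      ∧ ‖ddRlatW N (cM M₀) (wt N (cM M₀) (bondAvg N (cM M₀) μ₀)) a m2 μ ν x x'‖
          ≤ woodburyD2c ((N : ℝ) ^ 2 * m2) / (N : ℝ) ^ 4 :=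
  ⟨norm_RlatW_le N M₀ (admissible_bondAvg N (cM M₀) hN μ₀) hN ha hm2 x x',
   norm_dRlatW_le N M₀ (admissible_bondAvg N (cM M₀) hN μ₀) hN ha hm2 μ x x',
   norm_dRlatW'_le N M₀ (admissible_bondAvg N (cM M₀) hN μ₀) hN ha hm2 ν x x',
   norm_ddRlatW_le N M₀ (admissible_bondAvg N (cM M₀) hN μ₀) hN ha hm2 μ ν x x'⟩

/-- REAL PARTS IN THE ADAPTER'S SHAPE: the four massless bond bounds as `|Re R| ≤ D / (L:ℝ)^a`, `a = 2, 3, 3, 4` — the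
literal input shape of `WindowInterface.windowBound_of_scaleBound` (the kernels are real-valued in fact; only `|Re z| ≤ ‖z‖`
is used). [folklore] -/
theorem abs_re_Rbond_zero_le (hN : 1 ≤ N) {a : ℝ} (ha : 0 < a) (μ₀ μ ν : Fin 4) (x x' : Tor (fine N (cM M₀))) :
    |(RlatW N (cM M₀) (wt N (cM M₀) (bondAvg N (cM M₀) μ₀)) a 0 x x').re| ≤ woodburyDc 0 / (N : ℝ) ^ 2
      ∧ |(dRlatW N (cM M₀) (wt N (cM M₀) (bondAvg N (cM M₀) μ₀)) a 0 μ x x').re| ≤ woodburyD1c 0 / (N : ℝ) ^ 3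
      ∧ |(dRlatW' N (cM M₀) (wt N (cM M₀) (bondAvg N (cM M₀) μ₀)) a 0 ν x x').re| ≤ woodburyD1c 0 / (N : ℝ) ^ 3
      ∧ |(ddRlatW N (cM M₀) (wt N (cM M₀) (bondAvg N (cM M₀) μ₀)) a 0 μ ν x x').re| ≤ woodburyD2c 0 / (N : ℝ) ^ 4 := by
  obtain ⟨h0, h1, h2, h3⟩ := norm_Rbond_zero_le N M₀ hN ha μ₀ μ ν x x'
  exact ⟨(Complex.abs_re_le_norm _).trans h0, (Complex.abs_re_le_norm _).trans h1,
    (Complex.abs_re_le_norm _).trans h2, (Complex.abs_re_le_norm _).trans h3⟩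

/-- `d = 4` sanity: the bond certificate's hypotheses are jointly satisfiable and its constants are absolute numbers
(`N = 2`, `M₀ = 1`, `a = 1`). -/
example (x x' : Tor (fine 2 (cM 1))) (μ : Fin 4) :
    ‖RlatW 2 (cM 1) (wt 2 (cM 1) (bondAvg 2 (cM 1) μ)) 1 0 x x'‖ ≤ woodburyDc 0 / (2 : ℝ) ^ 2 := by
  simpa using (norm_Rbond_zero_le 2 1 (by norm_num) one_pos μ μ μ x x').1

end BondFour

end Literature.MathematicalPhysics.QuantumFieldTheory.Balaban1983to89.Beta.WoodburyCovariant

end
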